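import Mathlib.LinearAlgebra.Matrix.Permanent
import Mathlib.LinearAlgebra.Matrix.Notation
import Mathlib.Logic.Equiv.Fin.Basic
import Mathlib.Algebra.BigOperators.Fin
import Literature.LinearAlgebra.Matrix.PermanentLaplace
import Literature.LinearAlgebra.Matrix.PermanentSubperm
import Literature.Computability.AlgebraicComplexity.PermanentCompleteness
import HarnessLib

/-!
# Boolean sums of permanents are permanents (char `≠ 2`) — discharge of `BCS1997_thm_21_29`

D-0014 keeps `Literature/` free of `sorry` by stating cited results as named facts. This file
proves the named fact `Literature.Computability.AlgebraicComplexity.BCS1997_thm_21_29` of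
`PermanentCompleteness.lean` — Bürgisser–Clausen–Shokrollahi 1997, Thm. (21.29) (Valiant 1979),
the third printed step of Valiant's `VNP`-completeness of the permanent: suppose `char k ≠ 2`
and let `A = A(X, Y)` be an `N × N` matrix (`N ≥ 1`) over `k ∪ {X_i} ∪ {Y_1, …, Y_t}` having in
each column at most one entry not in `k`; then there is a matrix `A'` over `k ∪ {X_i}` of size
`N' ≤ 10 N` with `per A' = ∑_{e ∈ {0,1}^t} per A(X, e)`:

* `Literature.Computability.AlgebraicComplexity.BCS1997_thm_21_29_holds : BCS1997_thm_21_29 k`.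

## The printed proof and the one formalised

BCS (book pp. 558–563) eliminate all `Y`-variables at once with one block `A'[i]` per variable;
we eliminate ONE variable at a time (`gadget`, `permanent_gadgetM`), which gives the same matrix
up to the order of the blocks and lets the size bookkeeping be an induction on `t`
(`elim_boolSum`). For the variable `Y₀` with occurrences in the columns `s_1 < ⋯ < s_μ` (`yCol`;
by the column property the occurrence in the column `s_j` is its unique non-constant entry) the
matrix `A'` (`gadget`, on the index type `GIdx N μ = Fin N ⊕ (Fin μ × (Fin 4 ⊕ Fin 4)) ⊕ Unit`,
i.e. the original indices, the rows/columns `L_{j,1..4}`, `R_{j,1..4}` of the `j`-th pair of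
Valiant blocks, and the control index `c`) is read off the text of the printed proof:
the original block carries `A(Y₀ := 0)`; the column `R_{j4}` carries the column `s_j` of
`A(Y₀ := 1)`; the rows `L_j` and `R_j` carry the Valiant matrix
`V = ((0,1,-1,-1),(1,-1,1,1),(0,1,1,2),(0,1,3,0))` on their own columns and the unit entries
`(L_{j1}, ℓ_{j1})` with `ℓ_{j1} = L_{j+1,4}` (`= c` for `j = μ`), `(L_{j4}, R_{j1})`,
`(R_{j1}, s_j)`, `(R_{j4}, L_{j1})`; the control row has `ε` at `c` and at `L_{1,4}`
(BCS: "`C_i^* = C_i` or `C_i^* = {L_{i14}}`", "`ℓ_{ij1} = L_{i,j+1,4}`, `ℓ_{ij4} = R_{ij1}`,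
`r_{ij1} = s_{ij}`, `r_{ij4} = L_{ij1}`"). The printed proof evaluates `per A'` with the Laplace
Expansion Theorem (21.30) along the partition into all blocks at once and shows that only the
`2^t` partitions `(C)_0 / (C)_1` survive, through the alternatives `(L)_{ij0/1}`, `(R)_{ij0/1}`
and the domino property (D). We run the same argument as a CHAIN of two-part Laplace expansions
(`Matrix.subperm_laplace_forced` of `PermanentSubperm.lean`), each of which is forced: expanding
the control row (`permanent_gadgetM`) splits `per A'` into the state `e = 0` (control column
taken) and the state `e = 1` (`L_{1,4}` taken); in state `0` the blocks are peeled in increasing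
order (`st0_L_step`: rows `L_j` are forced onto `L_{j2}, L_{j3}, L_{j4}, R_{j1}`, block permanent
`per V[4|1] = 4`; `st0_R_step`: rows `R_j` onto `R_{j2}, R_{j3}, R_{j4}, L_{j1}`, permanent `4`),
ending with the original rows and columns, i.e. `per A(Y₀ := 0)` (`st0_end`); in state `1` the
blocks are peeled in DECREASING order, which makes every step forced as well (`st1_L_step`: rows
`L_j` onto `L_{j1}, L_{j2}, L_{j3}, ℓ_{j1}`, `per V[1|4] = 4`; `st1_R_step`: rows `R_j` onto
`R_{j1}, R_{j2}, R_{j3}, s_j`, permanent `4`), ending with the original rows and the columns in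
which every `s_j` is replaced by `R_{j4}`, i.e. `per A(Y₀ := 1)` (`st1_end`). The vanishing of
all other column choices is exactly the list of permanents of `V`-minors of the printed proof
(`per V = per V[1|1] = per V[4|4] = per V[1,4|1,4] = 0`), here evaluated on the explicit
`4 × 4` blocks (`permanent_valiantV`, `permanent_V_c0_e0`, …, via `permanent_fin_four_row`).
Hence `per A' = ε · 16^μ · (per A(Y₀:=0) + per A(Y₀:=1))` and `ε = 16^{-μ}` (`= 4^{-2μ}` as in
print; `char k ≠ 2`) gives the one-variable identity, of size `N + 8μ + 1`.

Size bookkeeping (`BCS1997_thm_21_29_holds`). Print assumes "w.l.o.g. each `Y_i` occurs" and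
gets `N' = N + ∑ (8μ_i + 1) ≤ 10N` from `t ≤ ∑ μ_i ≤ N`. Without that proviso (the named fact has
none) a non-occurring variable just doubles the sum; we realise the factor `2` by scaling a
constant row (`scaleRow`, size unchanged), so the induction `elim_boolSum` runs on matrices with
a constant row and yields `N' ≤ N + 9·occ` (`occ` = number of `Y`-occurrences, `yOcc`; the
gadget's control row is constant, so the invariant persists). Then: (I) if `A` has a constant
row, `occ ≤ N` (column property, `yOcc_le`) gives `N' ≤ 10N`; (III) if some entry is an
`X`-variable, its column carries no `Y`, so `occ ≤ N - 1` (`yOcc_le_pred`), and adjoining a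
`1 × 1` unit block (`extendOne`) first gives `N' ≤ N + 1 + 9(N-1) ≤ 10N`; (II) otherwise every
Boolean substitution of `A` is a constant matrix and the Boolean sum is the `1 × 1` matrix of its
value. The hypothesis `N ≥ 1` of the named fact is used in (III) and (II).

## Contents

* `substFirst`, `yCols`/`yMult`/`yCol`, `GIdx` (+ `L`, `R`, `c`, `o`), `valiantV`, `gadget`,
  `gadgetM`, entry lemmas and row/column supports.
* The chain: `St0`, `St0mid`, `St0row`, `st0_L_step`, `st0_R_step`, `st0_chain`, `st0_end`;
  `St1`, `St1mid`, `St1row`, `St1midrow`, `st1_L_step`, `st1_R_step`, `st1_chain`, `st1_end`;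
  `permanent_gadgetM`.
* Structure: `gadget_col_unique` (column property), `gadget_c_isLeft` (constant control row),
  `yOcc`, `yOcc_gadget`, `yOcc_eq_yMult_add`; `gadgetFin` (re-indexed to `Fin (N + 8μ + 1)`).
* `boolSubst_cons`, `sum_entryPer_boolSubst_succ`, `scaleRow`, `elim_boolSum`, `extendOne`,
  `BCS1997_thm_21_29_holds`.

## References

* P. Bürgisser, M. Clausen, M. A. Shokrollahi, *Algebraic Complexity Theory*, Grundlehren 315,
  Springer 1997, §21.4: Thm. (21.29) and its proof (the matrix `A'[i]`, the Valiant matrix `V`,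
  the alternatives `(L)`, `(R)`, `(C)` and the domino property), pp. 558–563; (21.30).
* L. G. Valiant, *Completeness classes in algebra*, Proc. 11th STOC (1979), 249–261.
-/

noncomputable section

open MvPolynomial Matrix Finset

namespace Literature.Computability.AlgebraicComplexity

universe u v

/-! ### One Boolean variable: the data of the gadget -/

section OneVariable

variable {k : Type u} {σ : Type v} {t N : ℕ}

/-- Substituting the constant `b` for the first `Y`-variable `Y₀` and renumbering the other
`Y`-variables (`Y_{j+1} ↦ Y_j`); constants and `X`-variables are kept
(BCS 1997, proof of Thm. (21.29): `A_δ`, "substituting each occurrence of `Y_i` by `δ`").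
[cite: BurgisserClausenShokrollahi1997, Thm. (21.29)] -/
def substFirst (b : k) : k ⊕ (σ ⊕ Fin (t + 1)) → k ⊕ (σ ⊕ Fin t)
  | Sum.inl c => Sum.inl c
  | Sum.inr (Sum.inl i) => Sum.inr (Sum.inl i)
  | Sum.inr (Sum.inr j) => Fin.cases (Sum.inl b) (fun j' => Sum.inr (Sum.inr j')) j

/-- Constants are kept by the substitution. [cite: BurgisserClausenShokrollahi1997, Thm. (21.29)] -/
@[simp] theorem substFirst_inl (b c : k) : (substFirst b (Sum.inl c) : k ⊕ (σ ⊕ Fin t)) = Sum.inl c := rfl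
/-- `X`-variables are kept by the substitution. [cite: BurgisserClausenShokrollahi1997, Thm. (21.29)] -/
@[simp] theorem substFirst_X (b : k) (i : σ) :
    (substFirst b (Sum.inr (Sum.inl i)) : k ⊕ (σ ⊕ Fin t)) = Sum.inr (Sum.inl i) := rfl
/-- `Y₀` becomes the constant `b`. [cite: BurgisserClausenShokrollahi1997, Thm. (21.29)] -/
@[simp] theorem substFirst_Y_zero (b : k) :
    (substFirst b (Sum.inr (Sum.inr 0)) : k ⊕ (σ ⊕ Fin t)) = Sum.inl b := rfl
/-- The other `Y`-variables are renumbered. [cite: BurgisserClausenShokrollahi1997, Thm. (21.29)] -/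
@[simp] theorem substFirst_Y_succ (b : k) (j : Fin t) :
    (substFirst b (Sum.inr (Sum.inr j.succ)) : k ⊕ (σ ⊕ Fin t)) = Sum.inr (Sum.inr j) := rfl

variable (A : Matrix (Fin N) (Fin N) (k ⊕ (σ ⊕ Fin (t + 1))))

/-- The columns of `A` containing the variable `Y₀` (the indices `s_{i1} < ⋯ < s_{iμ_i}` of
BCS 1997, proof of Thm. (21.29)). [cite: BurgisserClausenShokrollahi1997, Thm. (21.29)] -/
def yCols : Finset (Fin N) := by
  classical exact univ.filter fun s => ∃ r, A r s = Sum.inr (Sum.inr 0)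

/-- The multiplicity `μ` of `Y₀` in `A` (number of columns containing it; under the column
property this is the number of occurrences). [cite: BurgisserClausenShokrollahi1997, Thm. (21.29)] -/
def yMult : ℕ := (yCols A).card

/-- The increasing enumeration `j ↦ s_j` of the columns containing `Y₀`. [cite: BurgisserClausenShokrollahi1997, Thm. (21.29)] -/
def yCol : Fin (yMult A) ↪o Fin N := (yCols A).orderEmbOfFin rfl

/-- Each enumerated column contains `Y₀`. [cite: BurgisserClausenShokrollahi1997, Thm. (21.29)] -/
theorem yCol_mem (j : Fin (yMult A)) : yCol A j ∈ yCols A :=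
  Finset.orderEmbOfFin_mem _ _ j

/-- The enumeration of the `Y₀`-columns is injective. [cite: BurgisserClausenShokrollahi1997, Thm. (21.29)] -/
theorem yCol_injective : Function.Injective (yCol A) := (yCol A).injective

/-- The index type of the matrix `A'`: the original indices, then for each occurrence `j` of
`Y₀` the four rows/columns `L_{j1..4}` and the four `R_{j1..4}`, and the control index `c`
(BCS 1997, proof of Thm. (21.29), block structure of `A'[i]`). [cite: BurgisserClausenShokrollahi1997, Thm. (21.29)] -/
abbrev GIdx (N μ : ℕ) : Type := Fin N ⊕ ((Fin μ × (Fin 4 ⊕ Fin 4)) ⊕ Unit)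

namespace GIdx

variable {μ : ℕ}

/-- The row/column `L_{j,p}`. [cite: BurgisserClausenShokrollahi1997, Thm. (21.29)] -/
abbrev L (j : Fin μ) (p : Fin 4) : GIdx N μ := Sum.inr (Sum.inl (j, Sum.inl p))
/-- The row/column `R_{j,p}`. [cite: BurgisserClausenShokrollahi1997, Thm. (21.29)] -/
abbrev R (j : Fin μ) (p : Fin 4) : GIdx N μ := Sum.inr (Sum.inl (j, Sum.inr p))
/-- The control row/column `c`. [cite: BurgisserClausenShokrollahi1997, Thm. (21.29)] -/
abbrev c : GIdx N μ := Sum.inr (Sum.inr ())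
/-- An original row/column. [cite: BurgisserClausenShokrollahi1997, Thm. (21.29)] -/
abbrev o (r : Fin N) : GIdx N μ := Sum.inl r

end GIdx

variable [CommRing k]

/-- The **Valiant matrix** `V` (BCS 1997, proof of Thm. (21.29)):
`per V = per V[1|1] = per V[4|4] = per V[1,4|1,4] = 0` and `per V[1|4] = per V[4|1] = 4`. [cite: BurgisserClausenShokrollahi1997, Thm. (21.29)] -/
def valiantV : Matrix (Fin 4) (Fin 4) k := !![0, 1, -1, -1; 1, -1, 1, 1; 0, 1, 1, 2; 0, 1, 3, 0]

open GIdx in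
/-- The matrix `A'` of BCS 1997, Thm. (21.29), for ONE Boolean variable `Y₀` of multiplicity
`μ ≥ 1` (its occurrences in the columns `s_j = yCol j`), with entries in `k ∪ {X_i} ∪ {Y_1,…}`
(the remaining `Y`-variables renumbered) and a free scalar `ε` in the control row:
rows/columns `N ⊔ ⨆_j (L_j ⊔ R_j) ⊔ {c}`; the original block carries `A(Y₀ := 0)`, the column
`R_{j4}` carries the column `s_j` of `A(Y₀ := 1)`; the rows `L_j`, `R_j` carry the Valiant
matrix `V` and the unit entries `(L_{j1}, ℓ_{j1})`, `ℓ_{j1} = L_{j+1,4}` resp. `c` for the last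
`j`, `(L_{j4}, R_{j1})`, `(R_{j1}, s_j)`, `(R_{j4}, L_{j1})`; the control row has `ε` at `c`
and at `L_{1,4}` (0-indexed below: `p = 0, …, 3`). [cite: BurgisserClausenShokrollahi1997, Thm. (21.29)] -/
def gadget (ε : k) : Matrix (GIdx N (yMult A)) (GIdx N (yMult A)) (k ⊕ (σ ⊕ Fin t)) := fun x y =>
  match x, y with
  | Sum.inl r, Sum.inl s => substFirst 0 (A r s)
  | Sum.inl r, Sum.inr (Sum.inl (j, Sum.inr p)) =>
      if p = 3 then substFirst 1 (A r (yCol A j)) else Sum.inl 0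
  | Sum.inl _, Sum.inr (Sum.inl (_, Sum.inl _)) => Sum.inl 0
  | Sum.inl _, Sum.inr (Sum.inr ()) => Sum.inl 0
  | Sum.inr (Sum.inl (j, Sum.inl p)), Sum.inr (Sum.inl (j', Sum.inl p')) =>
      if j = j' then Sum.inl (valiantV p p')
      else if p = 0 ∧ p' = 3 ∧ j'.val = j.val + 1 then Sum.inl 1 else Sum.inl 0
  | Sum.inr (Sum.inl (j, Sum.inl p)), Sum.inr (Sum.inr ()) =>
      if p = 0 ∧ j.val + 1 = yMult A then Sum.inl 1 else Sum.inl 0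
  | Sum.inr (Sum.inl (j, Sum.inl p)), Sum.inr (Sum.inl (j', Sum.inr p')) =>
      if j = j' ∧ p = 3 ∧ p' = 0 then Sum.inl 1 else Sum.inl 0
  | Sum.inr (Sum.inl (_, Sum.inl _)), Sum.inl _ => Sum.inl 0
  | Sum.inr (Sum.inl (j, Sum.inr p)), Sum.inr (Sum.inl (j', Sum.inr p')) =>
      if j = j' then Sum.inl (valiantV p p') else Sum.inl 0
  | Sum.inr (Sum.inl (j, Sum.inr p)), Sum.inl s =>
      if p = 0 ∧ s = yCol A j then Sum.inl 1 else Sum.inl 0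
  | Sum.inr (Sum.inl (j, Sum.inr p)), Sum.inr (Sum.inl (j', Sum.inl p')) =>
      if j = j' ∧ p = 3 ∧ p' = 0 then Sum.inl 1 else Sum.inl 0
  | Sum.inr (Sum.inl (_, Sum.inr _)), Sum.inr (Sum.inr ()) => Sum.inl 0
  | Sum.inr (Sum.inr ()), Sum.inr (Sum.inr ()) => Sum.inl ε
  | Sum.inr (Sum.inr ()), Sum.inr (Sum.inl (j, Sum.inl p)) =>
      if j.val = 0 ∧ p = 3 then Sum.inl ε else Sum.inl 0
  | Sum.inr (Sum.inr ()), Sum.inr (Sum.inl (_, Sum.inr _)) => Sum.inl 0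
  | Sum.inr (Sum.inr ()), Sum.inl _ => Sum.inl 0

/-- The gadget matrix read in the polynomial ring. [cite: BurgisserClausenShokrollahi1997, Thm. (21.29)] -/
abbrev gadgetM (ε : k) : Matrix (GIdx N (yMult A)) (GIdx N (yMult A)) (MvPolynomial (σ ⊕ Fin t) k) :=
  (gadget A ε).map entryVal

section Entries

variable (ε : k)
open GIdx

/-- Entry formula of the gadget. [cite: BurgisserClausenShokrollahi1997, Thm. (21.29)] -/
@[simp] theorem gadget_o_o (r s : Fin N) : gadget A ε (o r) (o s) = substFirst 0 (A r s) := rfl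
/-- Entry formula of the gadget. [cite: BurgisserClausenShokrollahi1997, Thm. (21.29)] -/
@[simp] theorem gadget_o_R (r : Fin N) (j : Fin (yMult A)) (p : Fin 4) :
    gadget A ε (o r) (R j p) = if p = 3 then substFirst 1 (A r (yCol A j)) else Sum.inl 0 := rfl
/-- Entry formula of the gadget. [cite: BurgisserClausenShokrollahi1997, Thm. (21.29)] -/
@[simp] theorem gadget_o_L (r : Fin N) (j : Fin (yMult A)) (p : Fin 4) :
    gadget A ε (o r) (L j p) = Sum.inl 0 := rfl
/-- Entry formula of the gadget. [cite: BurgisserClausenShokrollahi1997, Thm. (21.29)] -/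
@[simp] theorem gadget_o_c (r : Fin N) : gadget A ε (o r) c = Sum.inl 0 := rfl
/-- Entry formula of the gadget. [cite: BurgisserClausenShokrollahi1997, Thm. (21.29)] -/
@[simp] theorem gadget_L_L (j j' : Fin (yMult A)) (p p' : Fin 4) :
    gadget A ε (L j p) (L j' p') = if j = j' then Sum.inl (valiantV p p')
      else if p = 0 ∧ p' = 3 ∧ j'.val = j.val + 1 then Sum.inl 1 else Sum.inl 0 := rfl
/-- Entry formula of the gadget. [cite: BurgisserClausenShokrollahi1997, Thm. (21.29)] -/
@[simp] theorem gadget_L_c (j : Fin (yMult A)) (p : Fin 4) :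
    gadget A ε (L j p) c = if p = 0 ∧ j.val + 1 = yMult A then Sum.inl 1 else Sum.inl 0 := rfl
/-- Entry formula of the gadget. [cite: BurgisserClausenShokrollahi1997, Thm. (21.29)] -/
@[simp] theorem gadget_L_R (j j' : Fin (yMult A)) (p p' : Fin 4) :
    gadget A ε (L j p) (R j' p') = if j = j' ∧ p = 3 ∧ p' = 0 then Sum.inl 1 else Sum.inl 0 := rfl
/-- Entry formula of the gadget. [cite: BurgisserClausenShokrollahi1997, Thm. (21.29)] -/
@[simp] theorem gadget_L_o (j : Fin (yMult A)) (p : Fin 4) (s : Fin N) :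
    gadget A ε (L j p) (o s) = Sum.inl 0 := rfl
/-- Entry formula of the gadget. [cite: BurgisserClausenShokrollahi1997, Thm. (21.29)] -/
@[simp] theorem gadget_R_R (j j' : Fin (yMult A)) (p p' : Fin 4) :
    gadget A ε (R j p) (R j' p') = if j = j' then Sum.inl (valiantV p p') else Sum.inl 0 := rfl
/-- Entry formula of the gadget. [cite: BurgisserClausenShokrollahi1997, Thm. (21.29)] -/
@[simp] theorem gadget_R_o (j : Fin (yMult A)) (p : Fin 4) (s : Fin N) :
    gadget A ε (R j p) (o s) = if p = 0 ∧ s = yCol A j then Sum.inl 1 else Sum.inl 0 := rfl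
/-- Entry formula of the gadget. [cite: BurgisserClausenShokrollahi1997, Thm. (21.29)] -/
@[simp] theorem gadget_R_L (j j' : Fin (yMult A)) (p p' : Fin 4) :
    gadget A ε (R j p) (L j' p') = if j = j' ∧ p = 3 ∧ p' = 0 then Sum.inl 1 else Sum.inl 0 := rfl
/-- Entry formula of the gadget. [cite: BurgisserClausenShokrollahi1997, Thm. (21.29)] -/
@[simp] theorem gadget_R_c (j : Fin (yMult A)) (p : Fin 4) : gadget A ε (R j p) c = Sum.inl 0 := rfl
/-- Entry formula of the gadget. [cite: BurgisserClausenShokrollahi1997, Thm. (21.29)] -/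
@[simp] theorem gadget_c_c : gadget A ε c c = Sum.inl ε := rfl
/-- Entry formula of the gadget. [cite: BurgisserClausenShokrollahi1997, Thm. (21.29)] -/
@[simp] theorem gadget_c_L (j : Fin (yMult A)) (p : Fin 4) :
    gadget A ε c (L j p) = if j.val = 0 ∧ p = 3 then Sum.inl ε else Sum.inl 0 := rfl
/-- Entry formula of the gadget. [cite: BurgisserClausenShokrollahi1997, Thm. (21.29)] -/
@[simp] theorem gadget_c_R (j : Fin (yMult A)) (p : Fin 4) : gadget A ε c (R j p) = Sum.inl 0 := rfl
/-- Entry formula of the gadget. [cite: BurgisserClausenShokrollahi1997, Thm. (21.29)] -/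
@[simp] theorem gadget_c_o (s : Fin N) : gadget A ε c (o s) = Sum.inl 0 := rfl

end Entries

end OneVariable

/-! ### Generic helpers for `4 × 4` blocks -/

section Vec4

variable {α : Type*}

/-- Membership in the range of a `4`-vector. [folklore] -/
theorem mem_range_vec4 (a b c d x : α) :
    x ∈ Set.range ![a, b, c, d] ↔ x = a ∨ x = b ∨ x = c ∨ x = d := by
  simp only [Set.mem_range]
  constructor
  · rintro ⟨i, rfl⟩
    fin_cases i <;> simp
  · rintro (rfl | rfl | rfl | rfl)
    · exact ⟨0, rfl⟩
    · exact ⟨1, rfl⟩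
    · exact ⟨2, rfl⟩
    · exact ⟨3, rfl⟩

/-- A `4`-vector with pairwise distinct entries is injective. [folklore] -/
theorem injective_vec4 {a b c d : α} (hab : a ≠ b) (hac : a ≠ c) (had : a ≠ d) (hbc : b ≠ c)
    (hbd : b ≠ d) (hcd : c ≠ d) : Function.Injective ![a, b, c, d] := by
  intro i j h
  fin_cases i <;> fin_cases j <;> simp_all [eq_comm]

/-- A `4`-element `Finset` literal is the range of the corresponding `4`-vector. [folklore] -/
theorem mem_finset4_iff_range [DecidableEq α] (a b c d x : α) :
    x ∈ ({a, b, c, d} : Finset α) ↔ x ∈ Set.range ![a, b, c, d] := by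
  rw [mem_range_vec4]; simp

end Vec4

/-! ### The chain of forced Laplace expansions (BCS 1997, proof of Thm. (21.29), pp. 561–563) -/

section Chain

open scoped Classical
open GIdx

variable {k : Type u} {σ : Type v} {t N : ℕ}
variable (A : Matrix (Fin N) (Fin N) (k ⊕ (σ ⊕ Fin (t + 1)))) (ε : k)

/-- Evaluation of a `4 × 4` block subpermanent of the gadget matrix with constant entries. [cite: BurgisserClausenShokrollahi1997, Thm. (21.29)] -/
theorem subperm_gadget_block [CommRing k] (v w : Fin 4 → GIdx N (yMult A)) (hv : Function.Injective v)
    (hw : Function.Injective w) (Nm : Matrix (Fin 4) (Fin 4) k)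
    (h : ∀ a b, gadget A ε (w a) (v b) = Sum.inl (Nm a b)) :
    (gadgetM A ε).subperm (· ∈ Set.range v) (· ∈ Set.range w) = C Nm.permanent := by
  rw [Matrix.subperm_range_eq_permanent _ v w hv hw]
  have hmat : (Matrix.of fun a b => gadgetM A ε (w a) (v b)) = Nm.map C := by
    ext a b
    simp [h]
  rw [hmat]
  exact Matrix.permanent_map_ringHom (C : k →+* MvPolynomial (σ ⊕ Fin t) k) Nm

/-! #### Numerical facts about the Valiant matrix -/

section Numeric

variable [CommRing k] in
/-- `per V = 0`. [cite: BurgisserClausenShokrollahi1997, Thm. (21.29)] -/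
theorem permanent_valiantV : (valiantV : Matrix (Fin 4) (Fin 4) k).permanent = 0 := by
  rw [Matrix.permanent_fin_four_row]; simp [valiantV]; norm_num

variable [CommRing k] in
/-- `V` with its first column replaced by `e₁`: `per V[1|1] = 0`. [cite: BurgisserClausenShokrollahi1997, Thm. (21.29)] -/
theorem permanent_V_c0_e0 :
    (!![1, 1, -1, -1; 0, -1, 1, 1; 0, 1, 1, 2; 0, 1, 3, 0] : Matrix (Fin 4) (Fin 4) k).permanent = 0 := by
  rw [Matrix.permanent_fin_four_row]; simp; norm_num

variable [CommRing k] in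
/-- `V` with its first column replaced by `e₄`: `per V[4|1] = 4`. [cite: BurgisserClausenShokrollahi1997, Thm. (21.29)] -/
theorem permanent_V_c0_e3 :
    (!![0, 1, -1, -1; 0, -1, 1, 1; 0, 1, 1, 2; 1, 1, 3, 0] : Matrix (Fin 4) (Fin 4) k).permanent = 4 := by
  rw [Matrix.permanent_fin_four_row]; simp; norm_num

end Numeric

/-! #### Stage predicates, state `e = 0` -/

/-- Columns/rows present at the start of stage `m` in state `0`: the original ones and the blocks
`≥ m` (the control row and column are gone). [cite: BurgisserClausenShokrollahi1997, Thm. (21.29)] -/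
def St0 {μ : ℕ} (m : ℕ) : GIdx N μ → Prop
  | Sum.inl _ => True
  | Sum.inr (Sum.inr ()) => False
  | Sum.inr (Sum.inl (j, _)) => m ≤ j.val

/-- Columns present after the `L`-step of stage `m` in state `0`. [cite: BurgisserClausenShokrollahi1997, Thm. (21.29)] -/
def St0mid {μ : ℕ} (m : ℕ) : GIdx N μ → Prop
  | Sum.inl _ => True
  | Sum.inr (Sum.inr ()) => False
  | Sum.inr (Sum.inl (j, Sum.inl p)) => m < j.val ∨ (j.val = m ∧ p = 0)
  | Sum.inr (Sum.inl (j, Sum.inr p)) => m < j.val ∨ (j.val = m ∧ p ≠ 0)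

/-- Rows present after the `L`-step of stage `m` in state `0`. [cite: BurgisserClausenShokrollahi1997, Thm. (21.29)] -/
def St0row {μ : ℕ} (m : ℕ) : GIdx N μ → Prop
  | Sum.inl _ => True
  | Sum.inr (Sum.inr ()) => False
  | Sum.inr (Sum.inl (j, Sum.inl _)) => m < j.val
  | Sum.inr (Sum.inl (j, Sum.inr _)) => m ≤ j.val

/-- The column `ℓ_{j1}` receiving the unit entry of the row `L_{j1}`: `L_{j+1,4}`, or the control
column for the last block. [cite: BurgisserClausenShokrollahi1997, Thm. (21.29)] -/
def xcol (j : Fin (yMult A)) : GIdx N (yMult A) :=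
  if h : j.val + 1 < yMult A then L ⟨j.val + 1, h⟩ 3 else c

/-- The four rows/columns `L_{j,·}`. [cite: BurgisserClausenShokrollahi1997, Thm. (21.29)] -/
def Lset (j : Fin (yMult A)) : Finset (GIdx N (yMult A)) := {L j 0, L j 1, L j 2, L j 3}

/-- The four rows/columns `R_{j,·}`. [cite: BurgisserClausenShokrollahi1997, Thm. (21.29)] -/
def Rset (j : Fin (yMult A)) : Finset (GIdx N (yMult A)) := {R j 0, R j 1, R j 2, R j 3}

/-- Membership in `L_j`. [cite: BurgisserClausenShokrollahi1997, Thm. (21.29)] -/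
theorem mem_Lset {j : Fin (yMult A)} {y : GIdx N (yMult A)} :
    y ∈ Lset A j ↔ y = L j 0 ∨ y = L j 1 ∨ y = L j 2 ∨ y = L j 3 := by
  simp [Lset]

/-- Membership in `R_j`. [cite: BurgisserClausenShokrollahi1997, Thm. (21.29)] -/
theorem mem_Rset {j : Fin (yMult A)} {y : GIdx N (yMult A)} :
    y ∈ Rset A j ↔ y = R j 0 ∨ y = R j 1 ∨ y = R j 2 ∨ y = R j 3 := by
  simp [Rset]

/-- `L_{j,p} ∈ L_j`. [cite: BurgisserClausenShokrollahi1997, Thm. (21.29)] -/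
theorem L_mem_Lset (j : Fin (yMult A)) (p : Fin 4) : L j p ∈ Lset A j := by
  rw [mem_Lset]; fin_cases p <;> simp

/-- `R_{j,p} ∈ R_j`. [cite: BurgisserClausenShokrollahi1997, Thm. (21.29)] -/
theorem R_mem_Rset (j : Fin (yMult A)) (p : Fin 4) : R j p ∈ Rset A j := by
  rw [mem_Rset]; fin_cases p <;> simp

/-- `|L_j| = 4`. [cite: BurgisserClausenShokrollahi1997, Thm. (21.29)] -/
theorem card_Lset (j : Fin (yMult A)) : (Lset A j).card = 4 := by
  rw [Lset, Finset.card_insert_of_notMem (by simp), Finset.card_insert_of_notMem (by simp),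
    Finset.card_pair (by simp)]

/-- `|R_j| = 4`. [cite: BurgisserClausenShokrollahi1997, Thm. (21.29)] -/
theorem card_Rset (j : Fin (yMult A)) : (Rset A j).card = 4 := by
  rw [Rset, Finset.card_insert_of_notMem (by simp), Finset.card_insert_of_notMem (by simp),
    Finset.card_pair (by simp)]

/-- `L_j` as the range of a `4`-vector. [cite: BurgisserClausenShokrollahi1997, Thm. (21.29)] -/
theorem Lset_eq_range (j : Fin (yMult A)) (y : GIdx N (yMult A)) :
    y ∈ Lset A j ↔ y ∈ Set.range ![L j 0, L j 1, L j 2, L j 3] := by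
  rw [mem_Lset, mem_range_vec4]

/-- `R_j` as the range of a `4`-vector. [cite: BurgisserClausenShokrollahi1997, Thm. (21.29)] -/
theorem Rset_eq_range (j : Fin (yMult A)) (y : GIdx N (yMult A)) :
    y ∈ Rset A j ↔ y ∈ Set.range ![R j 0, R j 1, R j 2, R j 3] := by
  rw [mem_Rset, mem_range_vec4]

/-- Membership in `L_j`, existential form. [cite: BurgisserClausenShokrollahi1997, Thm. (21.29)] -/
theorem mem_Lset_iff {j : Fin (yMult A)} {y : GIdx N (yMult A)} : y ∈ Lset A j ↔ ∃ p, y = L j p := by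
  rw [mem_Lset]
  constructor
  · rintro (rfl | rfl | rfl | rfl)
    · exact ⟨0, rfl⟩
    · exact ⟨1, rfl⟩
    · exact ⟨2, rfl⟩
    · exact ⟨3, rfl⟩
  · rintro ⟨p, rfl⟩
    fin_cases p <;> simp

/-- Membership in `R_j`, existential form. [cite: BurgisserClausenShokrollahi1997, Thm. (21.29)] -/
theorem mem_Rset_iff {j : Fin (yMult A)} {y : GIdx N (yMult A)} : y ∈ Rset A j ↔ ∃ p, y = R j p := by
  rw [mem_Rset]
  constructor
  · rintro (rfl | rfl | rfl | rfl)
    · exact ⟨0, rfl⟩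
    · exact ⟨1, rfl⟩
    · exact ⟨2, rfl⟩
    · exact ⟨3, rfl⟩
  · rintro ⟨p, rfl⟩
    fin_cases p <;> simp

/-! #### Supports of the rows and columns of the gadget -/

section Support

variable [CommRing k] {A ε}

/-- A constant-zero entry of the gadget reads `0` in the polynomial ring. [cite: BurgisserClausenShokrollahi1997, Thm. (21.29)] -/
theorem gadgetM_eq_zero {y i : GIdx N (yMult A)} (h : gadget A ε y i = Sum.inl 0) :
    gadgetM A ε y i = 0 := by
  simp [h]

/-- Support of a row `L_{j,p}`. [cite: BurgisserClausenShokrollahi1997, Thm. (21.29)] -/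
theorem gadget_L_row {j : Fin (yMult A)} {p : Fin 4} {i : GIdx N (yMult A)}
    (h : gadget A ε (L j p) i ≠ Sum.inl 0) : i ∈ Lset A j ∨ i = R j 0 ∨ i = xcol A j := by
  rcases i with s | ⟨⟨j', p' | p'⟩⟩ | ⟨⟨⟩⟩
  · simp at h
  · simp only [gadget_L_L] at h
    split_ifs at h with h1 h2
    · subst h1; exact Or.inl (L_mem_Lset A j p')
    · obtain ⟨-, rfl, h3⟩ := h2
      right; right
      have hlt : j.val + 1 < yMult A := h3 ▸ j'.isLt
      rw [xcol, dif_pos hlt]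
      congr 3
      exact Fin.ext h3
    · exact absurd rfl h
  · simp only [gadget_L_R] at h
    split_ifs at h with h1
    · obtain ⟨rfl, -, rfl⟩ := h1
      exact Or.inr (Or.inl rfl)
    · exact absurd rfl h
  · simp only [gadget_L_c] at h
    split_ifs at h with h1
    · right; right
      rw [xcol, dif_neg (by omega)]
    · exact absurd rfl h

/-- Support of a row `R_{j,p}`. [cite: BurgisserClausenShokrollahi1997, Thm. (21.29)] -/
theorem gadget_R_row {j : Fin (yMult A)} {p : Fin 4} {i : GIdx N (yMult A)}
    (h : gadget A ε (R j p) i ≠ Sum.inl 0) : i ∈ Rset A j ∨ i = o (yCol A j) ∨ i = L j 0 := by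
  rcases i with s | ⟨⟨j', p' | p'⟩⟩ | ⟨⟨⟩⟩
  · simp only [gadget_R_o] at h
    split_ifs at h with h1
    · exact Or.inr (Or.inl (by rw [h1.2]))
    · exact absurd rfl h
  · simp only [gadget_R_L] at h
    split_ifs at h with h1
    · obtain ⟨rfl, -, rfl⟩ := h1
      exact Or.inr (Or.inr rfl)
    · exact absurd rfl h
  · simp only [gadget_R_R] at h
    split_ifs at h with h1
    · subst h1; exact Or.inl (R_mem_Rset A j p')
    · exact absurd rfl h
  · simp at h

/-- Support of the control row. [cite: BurgisserClausenShokrollahi1997, Thm. (21.29)] -/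
theorem gadget_c_row {i : GIdx N (yMult A)} (h : gadget A ε c i ≠ Sum.inl 0) :
    i = c ∨ ∃ j : Fin (yMult A), j.val = 0 ∧ i = L j 3 := by
  rcases i with s | ⟨⟨j', p' | p'⟩⟩ | ⟨⟨⟩⟩
  · simp at h
  · simp only [gadget_c_L] at h
    split_ifs at h with h1
    · exact Or.inr ⟨j', h1.1, by rw [h1.2]⟩
    · exact absurd rfl h
  · simp at h
  · exact Or.inl rfl

/-- Support of a column `L_{j,p}`. [cite: BurgisserClausenShokrollahi1997, Thm. (21.29)] -/
theorem gadget_L_col {j : Fin (yMult A)} {p : Fin 4} {y : GIdx N (yMult A)}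
    (h : gadget A ε y (L j p) ≠ Sum.inl 0) :
    y ∈ Lset A j ∨ (p = 0 ∧ y = R j 3) ∨
      (p = 3 ∧ ((∃ j' : Fin (yMult A), y = L j' 0 ∧ j.val = j'.val + 1) ∨ (y = c ∧ j.val = 0))) := by
  rcases y with r | ⟨⟨j', p' | p'⟩⟩ | ⟨⟨⟩⟩
  · simp at h
  · simp only [gadget_L_L] at h
    split_ifs at h with h1 h2
    · subst h1; exact Or.inl (L_mem_Lset A j' p')
    · obtain ⟨rfl, rfl, h3⟩ := h2
      exact Or.inr (Or.inr ⟨rfl, Or.inl ⟨j', rfl, h3⟩⟩)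
    · exact absurd rfl h
  · simp only [gadget_R_L] at h
    split_ifs at h with h1
    · obtain ⟨rfl, rfl, rfl⟩ := h1
      exact Or.inr (Or.inl ⟨rfl, rfl⟩)
    · exact absurd rfl h
  · simp only [gadget_c_L] at h
    split_ifs at h with h1
    · exact Or.inr (Or.inr ⟨h1.2, Or.inr ⟨rfl, h1.1⟩⟩)
    · exact absurd rfl h

/-- Support of a column `R_{j,p}`. [cite: BurgisserClausenShokrollahi1997, Thm. (21.29)] -/
theorem gadget_R_col {j : Fin (yMult A)} {p : Fin 4} {y : GIdx N (yMult A)}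
    (h : gadget A ε y (R j p) ≠ Sum.inl 0) :
    y ∈ Rset A j ∨ (p = 0 ∧ y = L j 3) ∨ (p = 3 ∧ ∃ r, y = o r) := by
  rcases y with r | ⟨⟨j', p' | p'⟩⟩ | ⟨⟨⟩⟩
  · simp only [gadget_o_R] at h
    split_ifs at h with h1
    · exact Or.inr (Or.inr ⟨h1, r, rfl⟩)
    · exact absurd rfl h
  · simp only [gadget_L_R] at h
    split_ifs at h with h1
    · obtain ⟨rfl, rfl, rfl⟩ := h1
      exact Or.inr (Or.inl ⟨rfl, rfl⟩)
    · exact absurd rfl h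
  · simp only [gadget_R_R] at h
    split_ifs at h with h1
    · subst h1; exact Or.inl (R_mem_Rset A j' p')
    · exact absurd rfl h
  · simp at h

/-- Support of the control column. [cite: BurgisserClausenShokrollahi1997, Thm. (21.29)] -/
theorem gadget_c_col {y : GIdx N (yMult A)} (h : gadget A ε y c ≠ Sum.inl 0) :
    y = c ∨ ∃ j : Fin (yMult A), y = L j 0 ∧ j.val + 1 = yMult A := by
  rcases y with r | ⟨⟨j', p' | p'⟩⟩ | ⟨⟨⟩⟩
  · simp at h
  · simp only [gadget_L_c] at h
    split_ifs at h with h1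
    · exact Or.inr ⟨j', by rw [h1.1], h1.2⟩
    · exact absurd rfl h
  · simp at h
  · exact Or.inl rfl

/-- Support of an original column. [cite: BurgisserClausenShokrollahi1997, Thm. (21.29)] -/
theorem gadget_o_col {s : Fin N} {y : GIdx N (yMult A)} (h : gadget A ε y (o s) ≠ Sum.inl 0) :
    (∃ r, y = o r) ∨ ∃ j : Fin (yMult A), y = R j 0 ∧ s = yCol A j := by
  rcases y with r | ⟨⟨j', p' | p'⟩⟩ | ⟨⟨⟩⟩
  · exact Or.inl ⟨r, rfl⟩
  · simp at h
  · simp only [gadget_R_o] at h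
    split_ifs at h with h1
    · exact Or.inr ⟨j', by rw [h1.1], h1.2⟩
    · exact absurd rfl h
  · simp at h

end Support

/-! #### State `0`, `L`-step -/

section St0L

variable (j : Fin (yMult A))

/-- The four rows `L_j` are distinct. [cite: BurgisserClausenShokrollahi1997, Thm. (21.29)] -/
theorem injective_Lvec : Function.Injective ![(L j 0 : GIdx N (yMult A)), L j 1, L j 2, L j 3] :=
  injective_vec4 (by simp) (by simp) (by simp) (by simp) (by simp) (by simp)

/-- The four rows `R_j` are distinct. [cite: BurgisserClausenShokrollahi1997, Thm. (21.29)] -/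
theorem injective_Rvec : Function.Injective ![(R j 0 : GIdx N (yMult A)), R j 1, R j 2, R j 3] :=
  injective_vec4 (by simp) (by simp) (by simp) (by simp) (by simp) (by simp)

/-- The full Valiant block: `per V = 0`. [cite: BurgisserClausenShokrollahi1997, Thm. (21.29)] -/
theorem st0_L_block_V [CommRing k] : (gadgetM A ε).subperm
    (· ∈ ({L j 0, L j 1, L j 2, L j 3} : Finset (GIdx N (yMult A)))) (· ∈ Lset A j) = 0 := by
  rw [(gadgetM A ε).subperm_congr (fun i => mem_finset4_iff_range _ _ _ _ i) (Lset_eq_range A j),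
    subperm_gadget_block A ε _ _ (injective_Lvec A j) (injective_Lvec A j) valiantV (fun a b => by
      fin_cases a <;> fin_cases b <;> simp [valiantV]),
    permanent_valiantV, map_zero]

/-- The block `[e₁ | V₂ V₃ V₄]` of the column `ℓ_{j1}`: `per V[1|1] = 0`. [cite: BurgisserClausenShokrollahi1997, Thm. (21.29)] -/
theorem st0_L_block_x [CommRing k] (hlt : j.val + 1 < yMult A) : (gadgetM A ε).subperm
    (· ∈ ({L ⟨j.val + 1, hlt⟩ 3, L j 1, L j 2, L j 3} : Finset (GIdx N (yMult A)))) (· ∈ Lset A j) = 0 := by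
  have hne : j ≠ ⟨j.val + 1, hlt⟩ := fun h => by
    have := congrArg Fin.val h; simp at this
  have hne' : (⟨j.val + 1, hlt⟩ : Fin (yMult A)) ≠ j := fun h => hne h.symm
  have hvinj : Function.Injective ![(L ⟨j.val + 1, hlt⟩ 3 : GIdx N (yMult A)), L j 1, L j 2, L j 3] :=
    injective_vec4 (by simp [hne']) (by simp [hne']) (by simp [hne']) (by simp) (by simp) (by simp)
  rw [(gadgetM A ε).subperm_congr (fun i => mem_finset4_iff_range _ _ _ _ i) (Lset_eq_range A j),
    subperm_gadget_block A ε _ _ hvinj (injective_Lvec A j)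
      !![1, 1, -1, -1; 0, -1, 1, 1; 0, 1, 1, 2; 0, 1, 3, 0] (fun a b => by
      fin_cases a <;> fin_cases b <;> simp [valiantV, hne]),
    permanent_V_c0_e0, map_zero]

/-- The surviving block `[e₄ | V₂ V₃ V₄]`: `per V[4|1] = 4`. [cite: BurgisserClausenShokrollahi1997, Thm. (21.29)] -/
theorem st0_L_block_main [CommRing k] : (gadgetM A ε).subperm
    (· ∈ ({R j 0, L j 1, L j 2, L j 3} : Finset (GIdx N (yMult A)))) (· ∈ Lset A j) = C 4 := by
  have hvinj : Function.Injective ![(R j 0 : GIdx N (yMult A)), L j 1, L j 2, L j 3] :=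
    injective_vec4 (by simp) (by simp) (by simp) (by simp) (by simp) (by simp)
  rw [(gadgetM A ε).subperm_congr (fun i => mem_finset4_iff_range _ _ _ _ i) (Lset_eq_range A j),
    subperm_gadget_block A ε _ _ hvinj (injective_Lvec A j)
      !![0, 1, -1, -1; 0, -1, 1, 1; 0, 1, 1, 2; 1, 1, 3, 0] (fun a b => by
      fin_cases a <;> fin_cases b <;> simp [valiantV]),
    permanent_V_c0_e3]

/-- Bookkeeping of the present columns after the `L`-step. [cite: BurgisserClausenShokrollahi1997, Thm. (21.29)] -/
theorem st0mid_iff (i : GIdx N (yMult A)) :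
    (St0 (μ := yMult A) j.val i ∧ i ∉ ({R j 0, L j 1, L j 2, L j 3} : Finset (GIdx N (yMult A)))) ↔
      St0mid (μ := yMult A) j.val i := by
  rcases i with s | ⟨⟨j', p' | p'⟩⟩ | ⟨⟨⟩⟩
  · simp [St0, St0mid]
  · simp only [St0, St0mid, Finset.mem_insert, Finset.mem_singleton]
    by_cases hjj : j' = j
    · subst hjj
      constructor
      · rintro ⟨-, h⟩
        right
        refine ⟨rfl, ?_⟩
        fin_cases p' <;> simp_all
      · rintro (h | ⟨-, rfl⟩)
        · omega
        · simp
    · have hv : j'.val ≠ j.val := fun h => hjj (Fin.ext h)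
      simp [hjj]
      omega
  · simp only [St0, St0mid, Finset.mem_insert, Finset.mem_singleton]
    by_cases hjj : j' = j
    · subst hjj
      constructor
      · rintro ⟨-, h⟩
        right
        refine ⟨rfl, ?_⟩
        rintro rfl
        simp at h
      · rintro (h | ⟨-, hp⟩)
        · omega
        · simp [hp]
    · have hv : j'.val ≠ j.val := fun h => hjj (Fin.ext h)
      simp [hjj]
      omega
  · simp [St0, St0mid]

/-- Bookkeeping of the present rows after the `L`-step. [cite: BurgisserClausenShokrollahi1997, Thm. (21.29)] -/
theorem st0row_iff (y : GIdx N (yMult A)) :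
    (St0 (μ := yMult A) j.val y ∧ y ∉ Lset A j) ↔ St0row (μ := yMult A) j.val y := by
  rcases y with s | ⟨⟨j', p' | p'⟩⟩ | ⟨⟨⟩⟩
  · simp [St0, St0row, Lset]
  · by_cases hjj : j' = j
    · subst hjj
      simp only [St0, St0row, lt_self_iff_false, iff_false, not_and, not_not]
      intro _
      exact L_mem_Lset A j' p'
    · have hv : j'.val ≠ j.val := fun h => hjj (Fin.ext h)
      simp [St0, St0row, Lset, hjj]
      omega
  · simp [St0, St0row, Lset]
  · simp [St0, St0row, Lset]

/-- **State `0`, `L`-step**: at stage `j` the rows `L_j` are forced onto the columns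
`L_{j2}, L_{j3}, L_{j4}, R_{j1}` with block permanent `per V[4|1] = 4`. [cite: BurgisserClausenShokrollahi1997, Thm. (21.29)] -/
theorem st0_L_step [CommRing k] :
    (gadgetM A ε).subperm (St0 j.val) (St0 j.val) =
      C 4 * (gadgetM A ε).subperm (St0mid j.val) (St0row j.val) := by
  have hBq : ∀ y ∈ Lset A j, St0 (μ := yMult A) j.val y := by
    intro y hy
    obtain ⟨p, rfl⟩ := (mem_Lset_iff A).1 hy
    exact le_rfl
  -- support of the block rows
  have hT : ∀ y ∈ Lset A j, ∀ i, St0 (μ := yMult A) j.val i →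
      i ∉ ({L j 0, L j 1, L j 2, L j 3, R j 0, xcol A j} : Finset _) → gadgetM A ε y i = 0 := by
    intro y hy i _ hiT
    obtain ⟨p, rfl⟩ := (mem_Lset_iff A).1 hy
    apply gadgetM_eq_zero
    by_contra h
    rcases gadget_L_row h with h1 | rfl | rfl
    · rw [mem_Lset] at h1
      rcases h1 with rfl | rfl | rfl | rfl <;> simp at hiT
    · simp at hiT
    · simp at hiT
  -- the forced columns `L_{j,1..3}` are supported in the block rows among the present rows
  have hF : ∀ i ∈ ({L j 1, L j 2, L j 3} : Finset (GIdx N (yMult A))), ∀ y,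
      St0 (μ := yMult A) j.val y → y ∉ Lset A j → gadgetM A ε y i = 0 := by
    intro i hi y hy hyB
    simp only [Finset.mem_insert, Finset.mem_singleton] at hi
    apply gadgetM_eq_zero
    by_contra h
    have key : ∀ p : Fin 4, p ≠ 0 → gadget A ε y (L j p) ≠ Sum.inl 0 → False := by
      intro p hp h
      rcases gadget_L_col h with h1 | ⟨rfl, -⟩ | ⟨rfl, ⟨j', rfl, hj'⟩ | ⟨rfl, -⟩⟩
      · exact hyB h1
      · exact hp rfl
      · change j.val ≤ j'.val at hy; omega
      · exact hy
    rcases hi with rfl | rfl | rfl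
    · exact key 1 (by decide) h
    · exact key 2 (by decide) h
    · exact key 3 (by decide) h
  have hcardF : ({L j 1, L j 2, L j 3} : Finset (GIdx N (yMult A))).card + 1 = (Lset A j).card := by
    rw [card_Lset, Finset.card_insert_of_notMem (by simp), Finset.card_pair (by simp)]
  have hzero : ∀ z ∈ ({L j 0, L j 1, L j 2, L j 3, R j 0, xcol A j} : Finset (GIdx N (yMult A))),
      St0 (μ := yMult A) j.val z → z ∉ ({L j 1, L j 2, L j 3} : Finset (GIdx N (yMult A))) →
      z ≠ R j 0 →
      (gadgetM A ε).subperm (· ∈ insert z ({L j 1, L j 2, L j 3} : Finset (GIdx N (yMult A))))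
        (· ∈ Lset A j) = 0 := by
    intro z hz hSt hzF hz0
    simp only [Finset.mem_insert, Finset.mem_singleton] at hz hzF
    rcases hz with rfl | rfl | rfl | rfl | rfl | rfl
    · exact st0_L_block_V A ε j
    · simp at hzF
    · simp at hzF
    · simp at hzF
    · exact absurd rfl hz0
    · by_cases hlt : j.val + 1 < yMult A
      · have hx : xcol A j = L ⟨j.val + 1, hlt⟩ 3 := by rw [xcol, dif_pos hlt]
        rw [hx]
        exact st0_L_block_x A ε j hlt
      · exfalso
        rw [xcol, dif_neg hlt] at hSt
        exact hSt
  rw [(gadgetM A ε).subperm_laplace_forced (Lset A j) hBq _ hT {L j 1, L j 2, L j 3}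
      (fun i hi => by
        simp only [Finset.mem_insert, Finset.mem_singleton] at hi
        rcases hi with rfl | rfl | rfl <;> exact le_rfl)
      hF (fun i hi => by
        simp only [Finset.mem_insert, Finset.mem_singleton] at hi ⊢
        rcases hi with rfl | rfl | rfl <;> simp)
      hcardF (R j 0) (by simp) le_rfl (by simp) hzero,
    st0_L_block_main A ε j]
  congr 1
  exact (gadgetM A ε).subperm_congr (st0mid_iff A j) (st0row_iff A j)

end St0L

/-! #### State `0`, `R`-step -/

section St0R

variable (j : Fin (yMult A))

variable [CommRing k] in
/-- `[e₁ | V₂ V₃ | e₄]`: `per V[1,4|1,4] = 0`. [cite: BurgisserClausenShokrollahi1997, Thm. (21.29)] -/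
theorem permanent_V_e0_V1_V2_e3 :
    (!![1, 1, -1, 0; 0, -1, 1, 0; 0, 1, 1, 0; 0, 1, 3, 1] : Matrix (Fin 4) (Fin 4) k).permanent = 0 := by
  rw [Matrix.permanent_fin_four_row]; simp

variable [CommRing k] in
/-- `[V₄ | V₂ V₃ | e₄]`: `per V[4|1] = 4` (columns reordered). [cite: BurgisserClausenShokrollahi1997, Thm. (21.29)] -/
theorem permanent_V3_V1_V2_e3 :
    (!![-1, 1, -1, 0; 1, -1, 1, 0; 2, 1, 1, 0; 0, 1, 3, 1] : Matrix (Fin 4) (Fin 4) k).permanent = 4 := by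
  rw [Matrix.permanent_fin_four_row]; simp; norm_num

/-- The block of the site column `s_j`: `[e₁ | V₂ V₃ | e₄]`, permanent `0`. [cite: BurgisserClausenShokrollahi1997, Thm. (21.29)] -/
theorem st0_R_block_s [CommRing k] : (gadgetM A ε).subperm
    (· ∈ ({o (yCol A j), R j 1, R j 2, L j 0} : Finset (GIdx N (yMult A)))) (· ∈ Rset A j) = 0 := by
  have hvinj : Function.Injective ![(o (yCol A j) : GIdx N (yMult A)), R j 1, R j 2, L j 0] :=
    injective_vec4 (by simp) (by simp) (by simp) (by simp) (by simp) (by simp)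
  rw [(gadgetM A ε).subperm_congr (fun i => mem_finset4_iff_range _ _ _ _ i) (Rset_eq_range A j),
    subperm_gadget_block A ε _ _ hvinj (injective_Rvec A j)
      !![1, 1, -1, 0; 0, -1, 1, 0; 0, 1, 1, 0; 0, 1, 3, 1] (fun a b => by
      fin_cases a <;> fin_cases b <;> simp [valiantV]),
    permanent_V_e0_V1_V2_e3, map_zero]

/-- The surviving block `[V₄ | V₂ V₃ | e₄]`, permanent `4`. [cite: BurgisserClausenShokrollahi1997, Thm. (21.29)] -/
theorem st0_R_block_main [CommRing k] : (gadgetM A ε).subperm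
    (· ∈ ({R j 3, R j 1, R j 2, L j 0} : Finset (GIdx N (yMult A)))) (· ∈ Rset A j) = C 4 := by
  have hvinj : Function.Injective ![(R j 3 : GIdx N (yMult A)), R j 1, R j 2, L j 0] :=
    injective_vec4 (by simp) (by simp) (by simp) (by simp) (by simp) (by simp)
  rw [(gadgetM A ε).subperm_congr (fun i => mem_finset4_iff_range _ _ _ _ i) (Rset_eq_range A j),
    subperm_gadget_block A ε _ _ hvinj (injective_Rvec A j)
      !![-1, 1, -1, 0; 1, -1, 1, 0; 2, 1, 1, 0; 0, 1, 3, 1] (fun a b => by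
      fin_cases a <;> fin_cases b <;> simp [valiantV]),
    permanent_V3_V1_V2_e3]

/-- Bookkeeping of the present columns after the `R`-step. [cite: BurgisserClausenShokrollahi1997, Thm. (21.29)] -/
theorem st0_next_iff (i : GIdx N (yMult A)) :
    (St0mid (μ := yMult A) j.val i ∧ i ∉ ({R j 3, R j 1, R j 2, L j 0} : Finset (GIdx N (yMult A)))) ↔
      St0 (μ := yMult A) (j.val + 1) i := by
  rcases i with s | ⟨⟨j', p' | p'⟩⟩ | ⟨⟨⟩⟩
  · simp [St0, St0mid]
  · simp only [St0, St0mid, Finset.mem_insert, Finset.mem_singleton]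
    by_cases hjj : j' = j
    · subst hjj
      simp
    · have hv : j'.val ≠ j.val := fun h => hjj (Fin.ext h)
      simp [hjj]
      omega
  · simp only [St0, St0mid, Finset.mem_insert, Finset.mem_singleton]
    by_cases hjj : j' = j
    · subst hjj
      constructor
      · rintro ⟨h | ⟨-, hp⟩, h2⟩
        · omega
        · exfalso
          fin_cases p' <;> simp_all
      · intro h; omega
    · have hv : j'.val ≠ j.val := fun h => hjj (Fin.ext h)
      simp [hjj]
      omega
  · simp [St0, St0mid]

/-- Bookkeeping of the present rows after the `R`-step. [cite: BurgisserClausenShokrollahi1997, Thm. (21.29)] -/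
theorem st0row_next_iff (y : GIdx N (yMult A)) :
    (St0row (μ := yMult A) j.val y ∧ y ∉ Rset A j) ↔ St0 (μ := yMult A) (j.val + 1) y := by
  rcases y with s | ⟨⟨j', p' | p'⟩⟩ | ⟨⟨⟩⟩
  · simp [St0, St0row, Rset]
  · simp only [St0, St0row]
    simp [mem_Rset]
  · simp only [St0, St0row]
    by_cases hjj : j' = j
    · subst hjj
      constructor
      · rintro ⟨-, h⟩
        exact absurd (R_mem_Rset A j' p') h
      · intro h; omega
    · have hv : j'.val ≠ j.val := fun h => hjj (Fin.ext h)
      simp [mem_Rset, hjj]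
      omega
  · simp [St0, St0row, Rset]

/-- **State `0`, `R`-step**: the rows `R_j` are forced onto `R_{j2}, R_{j3}, R_{j4}, L_{j1}` with
block permanent `4`. [cite: BurgisserClausenShokrollahi1997, Thm. (21.29)] -/
theorem st0_R_step [CommRing k] :
    (gadgetM A ε).subperm (St0mid j.val) (St0row j.val) =
      C 4 * (gadgetM A ε).subperm (St0 (j.val + 1)) (St0 (j.val + 1)) := by
  have hBq : ∀ y ∈ Rset A j, St0row (μ := yMult A) j.val y := by
    intro y hy
    obtain ⟨p, rfl⟩ := (mem_Rset_iff A).1 hy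
    exact le_rfl
  have hT : ∀ y ∈ Rset A j, ∀ i, St0mid (μ := yMult A) j.val i →
      i ∉ ({R j 0, R j 1, R j 2, R j 3, o (yCol A j), L j 0} : Finset _) → gadgetM A ε y i = 0 := by
    intro y hy i _ hiT
    obtain ⟨p, rfl⟩ := (mem_Rset_iff A).1 hy
    apply gadgetM_eq_zero
    by_contra h
    rcases gadget_R_row h with h1 | rfl | rfl
    · rw [mem_Rset] at h1
      rcases h1 with rfl | rfl | rfl | rfl <;> simp at hiT
    · simp at hiT
    · simp at hiT
  have hF : ∀ i ∈ ({R j 1, R j 2, L j 0} : Finset (GIdx N (yMult A))), ∀ y,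
      St0row (μ := yMult A) j.val y → y ∉ Rset A j → gadgetM A ε y i = 0 := by
    intro i hi y hy hyB
    simp only [Finset.mem_insert, Finset.mem_singleton] at hi
    apply gadgetM_eq_zero
    by_contra h
    rcases hi with rfl | rfl | rfl
    · rcases gadget_R_col h with h1 | ⟨h1, -⟩ | ⟨h1, -⟩
      · exact hyB h1
      · exact absurd h1 (by decide)
      · exact absurd h1 (by decide)
    · rcases gadget_R_col h with h1 | ⟨h1, -⟩ | ⟨h1, -⟩
      · exact hyB h1
      · exact absurd h1 (by decide)
      · exact absurd h1 (by decide)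
    · rcases gadget_L_col h with h1 | ⟨-, rfl⟩ | ⟨h1, -⟩
      · obtain ⟨p, rfl⟩ := (mem_Lset_iff A).1 h1
        exact absurd hy (lt_irrefl _)
      · exact hyB (R_mem_Rset A j 3)
      · exact absurd h1 (by decide)
  have hcardF : ({R j 1, R j 2, L j 0} : Finset (GIdx N (yMult A))).card + 1 = (Rset A j).card := by
    rw [card_Rset, Finset.card_insert_of_notMem (by simp), Finset.card_pair (by simp)]
  have hzero : ∀ z ∈ ({R j 0, R j 1, R j 2, R j 3, o (yCol A j), L j 0} : Finset (GIdx N (yMult A))),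
      St0mid (μ := yMult A) j.val z → z ∉ ({R j 1, R j 2, L j 0} : Finset (GIdx N (yMult A))) →
      z ≠ R j 3 →
      (gadgetM A ε).subperm (· ∈ insert z ({R j 1, R j 2, L j 0} : Finset (GIdx N (yMult A))))
        (· ∈ Rset A j) = 0 := by
    intro z hz hSt hzF hz0
    simp only [Finset.mem_insert, Finset.mem_singleton] at hz hzF
    rcases hz with rfl | rfl | rfl | rfl | rfl | rfl
    · exfalso
      simp [St0mid] at hSt
    · simp at hzF
    · simp at hzF
    · exact absurd rfl hz0
    · exact st0_R_block_s A ε j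
    · simp at hzF
  rw [(gadgetM A ε).subperm_laplace_forced (Rset A j) hBq _ hT {R j 1, R j 2, L j 0}
      (fun i hi => by
        simp only [Finset.mem_insert, Finset.mem_singleton] at hi
        rcases hi with rfl | rfl | rfl <;> simp [St0mid])
      hF (fun i hi => by
        simp only [Finset.mem_insert, Finset.mem_singleton] at hi ⊢
        rcases hi with rfl | rfl | rfl <;> simp)
      hcardF (R j 3) (by simp) (by simp [St0mid]) (by simp) hzero,
    st0_R_block_main A ε j]
  congr 1
  exact (gadgetM A ε).subperm_congr (st0_next_iff A j) (st0row_next_iff A j)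

end St0R

/-! #### State `0`: the chain -/

section St0Chain

variable [CommRing k]

/-- The state-`0` chain: after `m` blocks the subpermanent has picked up the factor `16^m`. [cite: BurgisserClausenShokrollahi1997, Thm. (21.29)] -/
theorem st0_chain (m : ℕ) (hm : m ≤ yMult A) :
    (gadgetM A ε).subperm (St0 0) (St0 0) =
      C ((16 : k) ^ m) * (gadgetM A ε).subperm (St0 m) (St0 m) := by
  induction m with
  | zero => simp
  | succ m ih =>
    have hlt : m < yMult A := hm
    rw [ih hlt.le, st0_L_step A ε ⟨m, hlt⟩, st0_R_step A ε ⟨m, hlt⟩, pow_succ, C_mul, ← mul_assoc,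
      ← mul_assoc]
    congr 1
    rw [mul_assoc, ← C_mul, ← C_mul, ← C_mul]
    norm_num

/-- End of state `0`: the original rows and columns with `Y₀ := 0`. [cite: BurgisserClausenShokrollahi1997, Thm. (21.29)] -/
theorem st0_end :
    (gadgetM A ε).subperm (St0 (yMult A)) (St0 (yMult A)) = entryPer (A.map (substFirst 0)) := by
  have hiff : ∀ i : GIdx N (yMult A), St0 (μ := yMult A) (yMult A) i ↔ i ∈ Set.range (o (μ := yMult A)) := by
    intro i
    rcases i with s | ⟨⟨j', pp⟩⟩ | ⟨⟨⟩⟩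
    · simp [St0]
    · simp only [St0, Set.mem_range]
      constructor
      · intro h; exact absurd j'.isLt (not_lt.2 h)
      · rintro ⟨r, hr⟩; simp at hr
    · simp [St0]
  rw [(gadgetM A ε).subperm_congr hiff hiff,
    (gadgetM A ε).subperm_range_eq_permanent _ _ Sum.inl_injective Sum.inl_injective]
  rfl

end St0Chain

/-! #### Stage predicates, state `e = 1` (blocks processed from the last to the first) -/

/-- Columns present in state `1` when the blocks `≥ m` have been processed: the original
columns except the sites `s_j`, `j ≥ m`; the control column until the last block takes it; of a
processed block only `R_{j4}`; of an unprocessed block everything except `L_{j4}` when it has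
already been consumed (`j = 0`: by the control row; `j > m`: by the block `j - 1`). [cite: BurgisserClausenShokrollahi1997, Thm. (21.29)] -/
def St1 (m : ℕ) : GIdx N (yMult A) → Prop
  | Sum.inl s => ∀ j' : Fin (yMult A), m ≤ j'.val → s ≠ yCol A j'
  | Sum.inr (Sum.inr ()) => m = yMult A
  | Sum.inr (Sum.inl (j', Sum.inl p)) => (p ≠ 3 ∧ j'.val < m) ∨ (p = 3 ∧ j'.val ≠ 0 ∧ j'.val ≤ m)
  | Sum.inr (Sum.inl (j', Sum.inr p)) => j'.val < m ∨ p = 3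

/-- Rows present in state `1` when the blocks `≥ m` have been processed. [cite: BurgisserClausenShokrollahi1997, Thm. (21.29)] -/
def St1row {μ : ℕ} (m : ℕ) : GIdx N μ → Prop
  | Sum.inl _ => True
  | Sum.inr (Sum.inr ()) => False
  | Sum.inr (Sum.inl (j', _)) => j'.val < m

/-- Columns present in state `1` after the `L`-step of the block `j`. [cite: BurgisserClausenShokrollahi1997, Thm. (21.29)] -/
def St1mid (j : ℕ) : GIdx N (yMult A) → Prop
  | Sum.inl s => ∀ j' : Fin (yMult A), j < j'.val → s ≠ yCol A j'
  | Sum.inr (Sum.inr ()) => False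
  | Sum.inr (Sum.inl (j', Sum.inl p)) => (p ≠ 3 ∧ j'.val < j) ∨ (p = 3 ∧ j'.val ≠ 0 ∧ j'.val ≤ j)
  | Sum.inr (Sum.inl (j', Sum.inr p)) => j'.val ≤ j ∨ p = 3

/-- Rows present in state `1` after the `L`-step of the block `j`. [cite: BurgisserClausenShokrollahi1997, Thm. (21.29)] -/
def St1midrow {μ : ℕ} (j : ℕ) : GIdx N μ → Prop
  | Sum.inl _ => True
  | Sum.inr (Sum.inr ()) => False
  | Sum.inr (Sum.inl (j', Sum.inl _)) => j'.val < j
  | Sum.inr (Sum.inl (j', Sum.inr _)) => j'.val ≤ j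

section Xcol

variable {A}
variable (j : Fin (yMult A))

/-- `ℓ_{j1}` is not one of the `L_j`. [cite: BurgisserClausenShokrollahi1997, Thm. (21.29)] -/
theorem xcol_ne_L (p : Fin 4) : xcol A j ≠ L j p := by
  unfold xcol; split_ifs with h
  · simp only [ne_eq, Sum.inr.injEq, Sum.inl.injEq, Prod.mk.injEq, not_and]
    intro h1
    exact absurd (congrArg Fin.val h1) (by simp)
  · simp

/-- `ℓ_{j1}` is not an `R`-index. [cite: BurgisserClausenShokrollahi1997, Thm. (21.29)] -/
theorem xcol_ne_R (j' : Fin (yMult A)) (p : Fin 4) : xcol A j ≠ R j' p := by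
  unfold xcol; split_ifs with h <;> simp

/-- `ℓ_{j1}` is not an original index. [cite: BurgisserClausenShokrollahi1997, Thm. (21.29)] -/
theorem xcol_ne_o (s : Fin N) : xcol A j ≠ o s := by
  unfold xcol; split_ifs with h <;> simp

/-- Support of the column `ℓ_{j1}`. [cite: BurgisserClausenShokrollahi1997, Thm. (21.29)] -/
theorem gadget_xcol_col [CommRing k] {ε : k} {y : GIdx N (yMult A)} (h : gadget A ε y (xcol A j) ≠ Sum.inl 0) :
    y = L j 0 ∨ (∃ j' : Fin (yMult A), y ∈ Lset A j' ∧ j'.val = j.val + 1) ∨ y = c := by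
  unfold xcol at h
  split_ifs at h with hlt
  · rcases gadget_L_col h with h1 | ⟨h1, -⟩ | ⟨-, ⟨j', rfl, hj'⟩ | ⟨rfl, -⟩⟩
    · exact Or.inr (Or.inl ⟨_, h1, rfl⟩)
    · exact absurd h1 (by decide)
    · left
      have : j' = j := Fin.ext (by simp at hj'; omega)
      rw [this]
    · exact Or.inr (Or.inr rfl)
  · rcases gadget_c_col h with rfl | ⟨j', rfl, hj'⟩
    · exact Or.inr (Or.inr rfl)
    · left
      have : j' = j := Fin.ext (by omega)
      rw [this]

/-- The row entries at the column `ℓ_{j1}`: the unit vector `e₁` on the rows `L_j`. [cite: BurgisserClausenShokrollahi1997, Thm. (21.29)] -/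
theorem gadget_L_xcol [CommRing k] (ε : k) (p : Fin 4) :
    gadget A ε (L j p) (xcol A j) = if p = 0 then Sum.inl 1 else Sum.inl 0 := by
  unfold xcol
  split_ifs with hlt hp hp
  · have hne : j ≠ ⟨j.val + 1, hlt⟩ := fun h => by have := congrArg Fin.val h; simp at this
    simp [hne, hp]
  · have hne : j ≠ ⟨j.val + 1, hlt⟩ := fun h => by have := congrArg Fin.val h; simp at this
    simp [hne, hp]
  · simp [hp]; omega
  · simp [hp]

/-- `ℓ_{j1}` is still present at stage `j + 1` of state `1`. [cite: BurgisserClausenShokrollahi1997, Thm. (21.29)] -/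
theorem st1_xcol : St1 A (j.val + 1) (xcol A j) := by
  unfold xcol
  split_ifs with hlt
  · simp [St1]
  · simp [St1]; omega

end Xcol

/-! #### State `1`, `L`-step (block `j`, from stage `j + 1`) -/

section St1L

variable (j : Fin (yMult A))

variable [CommRing k] in
/-- `[V₄ | V₂ V₃ | e₁]`: `per V[1|1] = 0` (columns reordered). [cite: BurgisserClausenShokrollahi1997, Thm. (21.29)] -/
theorem permanent_V3_V1_V2_e0 :
    (!![-1, 1, -1, 1; 1, -1, 1, 0; 2, 1, 1, 0; 0, 1, 3, 0] : Matrix (Fin 4) (Fin 4) k).permanent = 0 := by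
  rw [Matrix.permanent_fin_four_row]; simp; norm_num

variable [CommRing k] in
/-- `[e₄ | V₂ V₃ | e₁]`: `per V[1,4|1,4] = 0` (columns reordered). [cite: BurgisserClausenShokrollahi1997, Thm. (21.29)] -/
theorem permanent_e3_V1_V2_e0 :
    (!![0, 1, -1, 1; 0, -1, 1, 0; 0, 1, 1, 0; 1, 1, 3, 0] : Matrix (Fin 4) (Fin 4) k).permanent = 0 := by
  rw [Matrix.permanent_fin_four_row]; simp

variable [CommRing k] in
/-- `[V₁ V₂ V₃ | e₁]`: `per V[1|4] = 4`. [cite: BurgisserClausenShokrollahi1997, Thm. (21.29)] -/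
theorem permanent_V0_V1_V2_e0 :
    (!![0, 1, -1, 1; 1, -1, 1, 0; 0, 1, 1, 0; 0, 1, 3, 0] : Matrix (Fin 4) (Fin 4) k).permanent = 4 := by
  rw [Matrix.permanent_fin_four_row]; simp; norm_num

/-- The column vector `(z, L_{j2}, L_{j3}, ℓ_{j1})` is injective for admissible `z`. [cite: BurgisserClausenShokrollahi1997, Thm. (21.29)] -/
theorem injective_xvec3 (z : GIdx N (yMult A)) (h1 : z ≠ L j 1) (h2 : z ≠ L j 2) (hx : z ≠ xcol A j) :
    Function.Injective ![z, L j 1, L j 2, xcol A j] :=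
  injective_vec4 h1 h2 hx (by simp) (xcol_ne_L j 1).symm (xcol_ne_L j 2).symm

/-- The block of `L_{j4}`: `[V₄ | V₂ V₃ | e₁]`, permanent `0`. [cite: BurgisserClausenShokrollahi1997, Thm. (21.29)] -/
theorem st1_L_block_L3 [CommRing k] : (gadgetM A ε).subperm
    (· ∈ ({L j 3, L j 1, L j 2, xcol A j} : Finset (GIdx N (yMult A)))) (· ∈ Lset A j) = 0 := by
  rw [(gadgetM A ε).subperm_congr (fun i => mem_finset4_iff_range _ _ _ _ i) (Lset_eq_range A j),
    subperm_gadget_block A ε _ _ (injective_xvec3 A j _ (by simp) (by simp) (xcol_ne_L j 3).symm)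
      (injective_Lvec A j)
      !![-1, 1, -1, 1; 1, -1, 1, 0; 2, 1, 1, 0; 0, 1, 3, 0] (fun a b => by
      fin_cases a <;> fin_cases b <;> simp [valiantV, gadget_L_xcol]),
    permanent_V3_V1_V2_e0, map_zero]

/-- The block of `R_{j1}`: `[e₄ | V₂ V₃ | e₁]`, permanent `0`. [cite: BurgisserClausenShokrollahi1997, Thm. (21.29)] -/
theorem st1_L_block_R0 [CommRing k] : (gadgetM A ε).subperm
    (· ∈ ({R j 0, L j 1, L j 2, xcol A j} : Finset (GIdx N (yMult A)))) (· ∈ Lset A j) = 0 := by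
  rw [(gadgetM A ε).subperm_congr (fun i => mem_finset4_iff_range _ _ _ _ i) (Lset_eq_range A j),
    subperm_gadget_block A ε _ _ (injective_xvec3 A j _ (by simp) (by simp) (xcol_ne_R j j 0).symm)
      (injective_Lvec A j)
      !![0, 1, -1, 1; 0, -1, 1, 0; 0, 1, 1, 0; 1, 1, 3, 0] (fun a b => by
      fin_cases a <;> fin_cases b <;> simp [valiantV, gadget_L_xcol]),
    permanent_e3_V1_V2_e0, map_zero]

/-- The surviving block `[V₁ V₂ V₃ | e₁]`, permanent `4`. [cite: BurgisserClausenShokrollahi1997, Thm. (21.29)] -/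
theorem st1_L_block_main [CommRing k] : (gadgetM A ε).subperm
    (· ∈ ({L j 0, L j 1, L j 2, xcol A j} : Finset (GIdx N (yMult A)))) (· ∈ Lset A j) = C 4 := by
  rw [(gadgetM A ε).subperm_congr (fun i => mem_finset4_iff_range _ _ _ _ i) (Lset_eq_range A j),
    subperm_gadget_block A ε _ _ (injective_xvec3 A j _ (by simp) (by simp) (xcol_ne_L j 0).symm)
      (injective_Lvec A j)
      !![0, 1, -1, 1; 1, -1, 1, 0; 0, 1, 1, 0; 0, 1, 3, 0] (fun a b => by
      fin_cases a <;> fin_cases b <;> simp [valiantV, gadget_L_xcol]),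
    permanent_V0_V1_V2_e0]

/-- Bookkeeping of the present columns after the state-`1` `L`-step. [cite: BurgisserClausenShokrollahi1997, Thm. (21.29)] -/
theorem st1mid_iff (i : GIdx N (yMult A)) :
    (St1 A (j.val + 1) i ∧ i ∉ ({L j 0, L j 1, L j 2, xcol A j} : Finset (GIdx N (yMult A)))) ↔
      St1mid A j.val i := by
  rcases i with s | ⟨⟨j', p' | p'⟩⟩ | ⟨⟨⟩⟩
  · simp only [St1, St1mid, Finset.mem_insert, Finset.mem_singleton]
    have hx := xcol_ne_o j s
    simp only [reduceCtorEq, false_or]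
    constructor
    · rintro ⟨h, -⟩ j' hj'
      exact h j' (by omega)
    · intro h
      refine ⟨fun j' hj' => h j' (by omega), fun hh => hx hh.symm⟩
  · simp only [St1, St1mid, Finset.mem_insert, Finset.mem_singleton]
    by_cases hjj : j' = j
    · subst hjj
      constructor
      · rintro ⟨h1 | ⟨rfl, h0, hle⟩, h2⟩
        · exfalso
          rcases h1 with ⟨hp3, -⟩
          apply h2
          fin_cases p' <;> simp_all
        · right
          refine ⟨rfl, h0, ?_⟩
          -- `L_{j,4} ∉ S` forces nothing new; but `j ≤ j` holds
          exact le_rfl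
      · rintro (⟨hp3, hlt⟩ | ⟨rfl, h0, hle⟩)
        · omega
        · refine ⟨Or.inr ⟨rfl, h0, by omega⟩, ?_⟩
          have hx := xcol_ne_L (A := A) j' 3
          simp [Ne.symm hx]
    · have hv : j'.val ≠ j.val := fun h => hjj (Fin.ext h)
      have hxL : ∀ p, (L j' p : GIdx N (yMult A)) ≠ xcol A j ∨ (p = 3 ∧ j'.val = j.val + 1) := by
        intro p
        unfold xcol
        split_ifs with hlt
        · by_cases hp : p = 3 ∧ j'.val = j.val + 1
          · exact Or.inr hp
          · left
            simp only [ne_eq, Sum.inr.injEq, Sum.inl.injEq, Prod.mk.injEq]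
            rintro ⟨h1, h2⟩
            apply hp
            refine ⟨by simpa using h2, ?_⟩
            have := congrArg Fin.val h1; simpa using this
        · left; simp
      constructor
      · rintro ⟨h1 | ⟨rfl, h0, hle⟩, h2⟩
        · left; exact ⟨h1.1, by omega⟩
        · right
          refine ⟨rfl, h0, ?_⟩
          rcases Nat.lt_or_ge j'.val (j.val + 1) with h | h
          · omega
          · exfalso
            have hj' : j'.val = j.val + 1 := by omega
            apply h2
            right; right; right
            unfold xcol
            rw [dif_pos (by omega)]
            congr 3
            exact Fin.ext hj'
      · rintro (⟨hp3, hlt⟩ | ⟨rfl, h0, hle⟩)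
        · refine ⟨Or.inl ⟨hp3, by omega⟩, ?_⟩
          rcases hxL p' with hx | ⟨hp, -⟩
          · simp [hjj, hx]
          · exact absurd hp hp3
        · refine ⟨Or.inr ⟨rfl, h0, by omega⟩, ?_⟩
          rcases hxL 3 with hx | ⟨-, hj'⟩
          · simp [hjj, hx]
          · omega
  · simp only [St1, St1mid, Finset.mem_insert, Finset.mem_singleton]
    have hx := xcol_ne_R (A := A) j j' p'
    simp only [reduceCtorEq, Sum.inr.injEq, Sum.inl.injEq, Prod.mk.injEq, and_false, false_or]
    constructor
    · rintro ⟨h, -⟩; omega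
    · intro h; exact ⟨by omega, fun hh => hx hh.symm⟩
  · simp only [St1, St1mid, Finset.mem_insert, Finset.mem_singleton]
    constructor
    · rintro ⟨h, h2⟩
      apply h2
      right; right; right
      unfold xcol
      rw [dif_neg (by omega)]
    · intro h; exact h.elim

/-- Bookkeeping of the present rows after the state-`1` `L`-step. [cite: BurgisserClausenShokrollahi1997, Thm. (21.29)] -/
theorem st1midrow_iff (y : GIdx N (yMult A)) :
    (St1row (μ := yMult A) (j.val + 1) y ∧ y ∉ Lset A j) ↔ St1midrow (μ := yMult A) j.val y := by
  rcases y with s | ⟨⟨j', p' | p'⟩⟩ | ⟨⟨⟩⟩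
  · simp [St1row, St1midrow, Lset]
  · simp only [St1row, St1midrow]
    by_cases hjj : j' = j
    · subst hjj
      constructor
      · rintro ⟨-, h⟩
        exact absurd (L_mem_Lset A j' p') h
      · intro h; exact absurd h (lt_irrefl _)
    · have hv : j'.val ≠ j.val := fun h => hjj (Fin.ext h)
      simp [mem_Lset, hjj]
      omega
  · simp only [St1row, St1midrow]
    simp [mem_Lset]
  · simp [St1row, St1midrow, Lset]

/-- **State `1`, `L`-step**: the rows `L_j` are forced onto `L_{j1}, L_{j2}, L_{j3}, ℓ_{j1}` with
block permanent `per V[1|4] = 4`. [cite: BurgisserClausenShokrollahi1997, Thm. (21.29)] -/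
theorem st1_L_step [CommRing k] :
    (gadgetM A ε).subperm (St1 A (j.val + 1)) (St1row (j.val + 1)) =
      C 4 * (gadgetM A ε).subperm (St1mid A j.val) (St1midrow j.val) := by
  have hBq : ∀ y ∈ Lset A j, St1row (μ := yMult A) (j.val + 1) y := by
    intro y hy
    obtain ⟨p, rfl⟩ := (mem_Lset_iff A).1 hy
    exact Nat.lt_succ_self _
  have hT : ∀ y ∈ Lset A j, ∀ i, St1 A (j.val + 1) i →
      i ∉ ({L j 0, L j 1, L j 2, L j 3, R j 0, xcol A j} : Finset _) → gadgetM A ε y i = 0 := by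
    intro y hy i _ hiT
    obtain ⟨p, rfl⟩ := (mem_Lset_iff A).1 hy
    apply gadgetM_eq_zero
    by_contra h
    rcases gadget_L_row h with h1 | rfl | rfl
    · rw [mem_Lset] at h1
      rcases h1 with rfl | rfl | rfl | rfl <;> simp at hiT
    · simp at hiT
    · simp at hiT
  have hF : ∀ i ∈ ({L j 1, L j 2, xcol A j} : Finset (GIdx N (yMult A))), ∀ y,
      St1row (μ := yMult A) (j.val + 1) y → y ∉ Lset A j → gadgetM A ε y i = 0 := by
    intro i hi y hy hyB
    simp only [Finset.mem_insert, Finset.mem_singleton] at hi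
    apply gadgetM_eq_zero
    by_contra h
    rcases hi with rfl | rfl | rfl
    · rcases gadget_L_col h with h1 | ⟨h1, -⟩ | ⟨h1, -⟩
      · exact hyB h1
      · exact absurd h1 (by decide)
      · exact absurd h1 (by decide)
    · rcases gadget_L_col h with h1 | ⟨h1, -⟩ | ⟨h1, -⟩
      · exact hyB h1
      · exact absurd h1 (by decide)
      · exact absurd h1 (by decide)
    · rcases gadget_xcol_col j h with rfl | ⟨j', h1, hj'⟩ | rfl
      · exact hyB (L_mem_Lset A j 0)
      · obtain ⟨p, rfl⟩ := (mem_Lset_iff A).1 h1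
        change j'.val < j.val + 1 at hy
        omega
      · exact hy
  have hcardF : ({L j 1, L j 2, xcol A j} : Finset (GIdx N (yMult A))).card + 1 = (Lset A j).card := by
    rw [card_Lset, Finset.card_insert_of_notMem (by simp [(xcol_ne_L j 1).symm]),
      Finset.card_pair (by simp [(xcol_ne_L j 2).symm])]
  have hzero : ∀ z ∈ ({L j 0, L j 1, L j 2, L j 3, R j 0, xcol A j} : Finset (GIdx N (yMult A))),
      St1 A (j.val + 1) z → z ∉ ({L j 1, L j 2, xcol A j} : Finset (GIdx N (yMult A))) →
      z ≠ L j 0 →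
      (gadgetM A ε).subperm (· ∈ insert z ({L j 1, L j 2, xcol A j} : Finset (GIdx N (yMult A))))
        (· ∈ Lset A j) = 0 := by
    intro z hz hSt hzF hz0
    simp only [Finset.mem_insert, Finset.mem_singleton] at hz hzF
    rcases hz with rfl | rfl | rfl | rfl | rfl | rfl
    · exact absurd rfl hz0
    · simp at hzF
    · simp at hzF
    · exact st1_L_block_L3 A ε j
    · exact st1_L_block_R0 A ε j
    · simp at hzF
  rw [(gadgetM A ε).subperm_laplace_forced (Lset A j) hBq _ hT {L j 1, L j 2, xcol A j}
      (fun i hi => by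
        simp only [Finset.mem_insert, Finset.mem_singleton] at hi
        rcases hi with rfl | rfl | rfl
        · simp [St1]
        · simp [St1]
        · exact st1_xcol j)
      hF (fun i hi => by
        simp only [Finset.mem_insert, Finset.mem_singleton] at hi ⊢
        rcases hi with rfl | rfl | rfl <;> simp)
      hcardF (L j 0) (by simp) (by simp [St1]) (by simp [(xcol_ne_L j 0).symm]) hzero,
    st1_L_block_main A ε j]
  congr 1
  exact (gadgetM A ε).subperm_congr (st1mid_iff A j) (st1midrow_iff A j)

end St1L

/-! #### State `1`, `R`-step (block `j`) -/

section St1R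

variable (j : Fin (yMult A))

variable [CommRing k] in
/-- `[V₄ | V₁ V₂ V₃]`: `per V = 0` (columns rotated). [cite: BurgisserClausenShokrollahi1997, Thm. (21.29)] -/
theorem permanent_V3_V0_V1_V2 :
    (!![-1, 0, 1, -1; 1, 1, -1, 1; 2, 0, 1, 1; 0, 0, 1, 3] : Matrix (Fin 4) (Fin 4) k).permanent = 0 := by
  rw [Matrix.permanent_fin_four_row]; simp; norm_num

variable [CommRing k] in
/-- `[e₁ | V₁ V₂ V₃]`: `per V[1|4] = 4` (columns rotated). [cite: BurgisserClausenShokrollahi1997, Thm. (21.29)] -/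
theorem permanent_e0_V0_V1_V2 :
    (!![1, 0, 1, -1; 0, 1, -1, 1; 0, 0, 1, 1; 0, 0, 1, 3] : Matrix (Fin 4) (Fin 4) k).permanent = 4 := by
  rw [Matrix.permanent_fin_four_row]; simp; norm_num

/-- The block of `R_{j4}`: `[V₄ | V₁ V₂ V₃]`, permanent `0`. [cite: BurgisserClausenShokrollahi1997, Thm. (21.29)] -/
theorem st1_R_block_R3 [CommRing k] : (gadgetM A ε).subperm
    (· ∈ ({R j 3, R j 0, R j 1, R j 2} : Finset (GIdx N (yMult A)))) (· ∈ Rset A j) = 0 := by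
  have hvinj : Function.Injective ![(R j 3 : GIdx N (yMult A)), R j 0, R j 1, R j 2] :=
    injective_vec4 (by simp) (by simp) (by simp) (by simp) (by simp) (by simp)
  rw [(gadgetM A ε).subperm_congr (fun i => mem_finset4_iff_range _ _ _ _ i) (Rset_eq_range A j),
    subperm_gadget_block A ε _ _ hvinj (injective_Rvec A j)
      !![-1, 0, 1, -1; 1, 1, -1, 1; 2, 0, 1, 1; 0, 0, 1, 3] (fun a b => by
      fin_cases a <;> fin_cases b <;> simp [valiantV]),
    permanent_V3_V0_V1_V2, map_zero]

/-- The surviving block `[e₁ | V₁ V₂ V₃]` of the site column `s_j`, permanent `4`. [cite: BurgisserClausenShokrollahi1997, Thm. (21.29)] -/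
theorem st1_R_block_main [CommRing k] : (gadgetM A ε).subperm
    (· ∈ ({o (yCol A j), R j 0, R j 1, R j 2} : Finset (GIdx N (yMult A)))) (· ∈ Rset A j) = C 4 := by
  have hvinj : Function.Injective ![(o (yCol A j) : GIdx N (yMult A)), R j 0, R j 1, R j 2] :=
    injective_vec4 (by simp) (by simp) (by simp) (by simp) (by simp) (by simp)
  rw [(gadgetM A ε).subperm_congr (fun i => mem_finset4_iff_range _ _ _ _ i) (Rset_eq_range A j),
    subperm_gadget_block A ε _ _ hvinj (injective_Rvec A j)
      !![1, 0, 1, -1; 0, 1, -1, 1; 0, 0, 1, 1; 0, 0, 1, 3] (fun a b => by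
      fin_cases a <;> fin_cases b <;> simp [valiantV]),
    permanent_e0_V0_V1_V2]

/-- Bookkeeping of the present columns after the state-`1` `R`-step. [cite: BurgisserClausenShokrollahi1997, Thm. (21.29)] -/
theorem st1_next_iff (i : GIdx N (yMult A)) :
    (St1mid A j.val i ∧ i ∉ ({o (yCol A j), R j 0, R j 1, R j 2} : Finset (GIdx N (yMult A)))) ↔
      St1 A j.val i := by
  rcases i with s | ⟨⟨j', p' | p'⟩⟩ | ⟨⟨⟩⟩
  · simp only [St1, St1mid, Finset.mem_insert, Finset.mem_singleton]
    simp only [Sum.inl.injEq, reduceCtorEq, or_false]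
    constructor
    · rintro ⟨h, hs⟩ j' hj'
      rcases Nat.lt_or_ge j.val j'.val with hlt | hge
      · exact h j' hlt
      · have : j' = j := Fin.ext (by omega)
        subst this
        exact hs
    · intro h
      exact ⟨fun j' hj' => h j' hj'.le, h j le_rfl⟩
  · simp only [St1, St1mid, Finset.mem_insert, Finset.mem_singleton]
    simp
  · simp only [St1, St1mid, Finset.mem_insert, Finset.mem_singleton]
    by_cases hjj : j' = j
    · subst hjj
      constructor
      · rintro ⟨-, h2⟩
        right
        fin_cases p' <;> simp_all
      · rintro (h | rfl)
        · omega
        · simp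
    · have hv : j'.val ≠ j.val := fun h => hjj (Fin.ext h)
      simp [hjj]
      omega
  · simp [St1, St1mid]
    omega

/-- Bookkeeping of the present rows after the state-`1` `R`-step. [cite: BurgisserClausenShokrollahi1997, Thm. (21.29)] -/
theorem st1row_next_iff (y : GIdx N (yMult A)) :
    (St1midrow (μ := yMult A) j.val y ∧ y ∉ Rset A j) ↔ St1row (μ := yMult A) j.val y := by
  rcases y with s | ⟨⟨j', p' | p'⟩⟩ | ⟨⟨⟩⟩
  · simp [St1row, St1midrow, Rset]
  · simp only [St1row, St1midrow]
    simp [mem_Rset]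
  · simp only [St1row, St1midrow]
    by_cases hjj : j' = j
    · subst hjj
      constructor
      · rintro ⟨-, h⟩
        exact absurd (R_mem_Rset A j' p') h
      · intro h; exact absurd h (lt_irrefl _)
    · have hv : j'.val ≠ j.val := fun h => hjj (Fin.ext h)
      simp [mem_Rset, hjj]
      omega
  · simp [St1row, St1midrow, Rset]

/-- **State `1`, `R`-step**: the rows `R_j` are forced onto `R_{j1}, R_{j2}, R_{j3}, s_j` with block
permanent `4`. [cite: BurgisserClausenShokrollahi1997, Thm. (21.29)] -/
theorem st1_R_step [CommRing k] :
    (gadgetM A ε).subperm (St1mid A j.val) (St1midrow j.val) =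
      C 4 * (gadgetM A ε).subperm (St1 A j.val) (St1row j.val) := by
  have hBq : ∀ y ∈ Rset A j, St1midrow (μ := yMult A) j.val y := by
    intro y hy
    obtain ⟨p, rfl⟩ := (mem_Rset_iff A).1 hy
    exact le_rfl
  have hT : ∀ y ∈ Rset A j, ∀ i, St1mid A j.val i →
      i ∉ ({R j 0, R j 1, R j 2, R j 3, o (yCol A j), L j 0} : Finset _) → gadgetM A ε y i = 0 := by
    intro y hy i _ hiT
    obtain ⟨p, rfl⟩ := (mem_Rset_iff A).1 hy
    apply gadgetM_eq_zero
    by_contra h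
    rcases gadget_R_row h with h1 | rfl | rfl
    · rw [mem_Rset] at h1
      rcases h1 with rfl | rfl | rfl | rfl <;> simp at hiT
    · simp at hiT
    · simp at hiT
  have hF : ∀ i ∈ ({R j 0, R j 1, R j 2} : Finset (GIdx N (yMult A))), ∀ y,
      St1midrow (μ := yMult A) j.val y → y ∉ Rset A j → gadgetM A ε y i = 0 := by
    intro i hi y hy hyB
    simp only [Finset.mem_insert, Finset.mem_singleton] at hi
    apply gadgetM_eq_zero
    by_contra h
    rcases hi with rfl | rfl | rfl
    · rcases gadget_R_col h with h1 | ⟨-, rfl⟩ | ⟨h1, -⟩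
      · exact hyB h1
      · exact absurd hy (lt_irrefl _)
      · exact absurd h1 (by decide)
    · rcases gadget_R_col h with h1 | ⟨h1, -⟩ | ⟨h1, -⟩
      · exact hyB h1
      · exact absurd h1 (by decide)
      · exact absurd h1 (by decide)
    · rcases gadget_R_col h with h1 | ⟨h1, -⟩ | ⟨h1, -⟩
      · exact hyB h1
      · exact absurd h1 (by decide)
      · exact absurd h1 (by decide)
  have hcardF : ({R j 0, R j 1, R j 2} : Finset (GIdx N (yMult A))).card + 1 = (Rset A j).card := by
    rw [card_Rset, Finset.card_insert_of_notMem (by simp), Finset.card_pair (by simp)]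
  have hzero : ∀ z ∈ ({R j 0, R j 1, R j 2, R j 3, o (yCol A j), L j 0} : Finset (GIdx N (yMult A))),
      St1mid A j.val z → z ∉ ({R j 0, R j 1, R j 2} : Finset (GIdx N (yMult A))) →
      z ≠ o (yCol A j) →
      (gadgetM A ε).subperm (· ∈ insert z ({R j 0, R j 1, R j 2} : Finset (GIdx N (yMult A))))
        (· ∈ Rset A j) = 0 := by
    intro z hz hSt hzF hz0
    simp only [Finset.mem_insert, Finset.mem_singleton] at hz hzF
    rcases hz with rfl | rfl | rfl | rfl | rfl | rfl
    · simp at hzF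
    · simp at hzF
    · simp at hzF
    · exact st1_R_block_R3 A ε j
    · exact absurd rfl hz0
    · exfalso
      simp [St1mid] at hSt
  rw [(gadgetM A ε).subperm_laplace_forced (Rset A j) hBq _ hT {R j 0, R j 1, R j 2}
      (fun i hi => by
        simp only [Finset.mem_insert, Finset.mem_singleton] at hi
        rcases hi with rfl | rfl | rfl <;> simp [St1mid])
      hF (fun i hi => by
        simp only [Finset.mem_insert, Finset.mem_singleton] at hi ⊢
        rcases hi with rfl | rfl | rfl <;> simp)
      hcardF (o (yCol A j)) (by simp)
      (by
        simp only [St1mid]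
        intro j' hj' h
        exact absurd (yCol_injective A h) (Fin.ne_of_lt hj'))
      (by simp) hzero,
    st1_R_block_main A ε j]
  congr 1
  exact (gadgetM A ε).subperm_congr (st1_next_iff A j) (st1row_next_iff A j)

end St1R

/-! #### State `1`: the chain and its end -/

section St1Chain

variable [CommRing k]

/-- The state-`1` chain: processing the last `n` blocks picks up the factor `16^n`. [cite: BurgisserClausenShokrollahi1997, Thm. (21.29)] -/
theorem st1_chain (n : ℕ) (hn : n ≤ yMult A) :
    (gadgetM A ε).subperm (St1 A (yMult A)) (St1row (yMult A)) =
      C ((16 : k) ^ n) * (gadgetM A ε).subperm (St1 A (yMult A - n)) (St1row (yMult A - n)) := by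
  induction n with
  | zero => simp
  | succ n ih =>
    have hlt : yMult A - (n + 1) < yMult A := by omega
    set j : Fin (yMult A) := ⟨yMult A - (n + 1), hlt⟩ with hj
    have hj1 : yMult A - n = j.val + 1 := by simp [hj]; omega
    rw [ih (by omega), hj1, st1_L_step A ε j, st1_R_step A ε j, pow_succ, C_mul]
    change _ = _ * (gadgetM A ε).subperm (St1 A j.val) (St1row j.val)
    rw [← mul_assoc, ← mul_assoc]
    congr 1
    rw [mul_assoc, ← C_mul, ← C_mul, ← C_mul]
    norm_num

/-- The index of a column containing `Y₀` in the enumeration `yCol`. [cite: BurgisserClausenShokrollahi1997, Thm. (21.29)] -/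
def yIdx (s : Fin N) (h : s ∈ yCols A) : Fin (yMult A) := ((yCols A).orderIsoOfFin rfl).symm ⟨s, h⟩

omit [CommRing k] in
/-- `yCol ∘ yIdx = id` on the `Y₀`-columns. [cite: BurgisserClausenShokrollahi1997, Thm. (21.29)] -/
theorem yCol_yIdx (s : Fin N) (h : s ∈ yCols A) : yCol A (yIdx A s h) = s := by
  have := ((yCols A).orderIsoOfFin rfl).apply_symm_apply ⟨s, h⟩
  have h2 := congrArg Subtype.val this
  rw [Finset.coe_orderIsoOfFin_apply] at h2
  exact h2

omit [CommRing k] in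
/-- `yIdx ∘ yCol = id`. [cite: BurgisserClausenShokrollahi1997, Thm. (21.29)] -/
theorem yIdx_yCol (j : Fin (yMult A)) (h : yCol A j ∈ yCols A) : yIdx A (yCol A j) h = j :=
  yCol_injective A (yCol_yIdx A _ h)

omit [CommRing k] in
/-- Unfolding of `yCols`. [cite: BurgisserClausenShokrollahi1997, Thm. (21.29)] -/
theorem mem_yCols_iff (s : Fin N) : s ∈ yCols A ↔ ∃ r, A r s = Sum.inr (Sum.inr 0) := by
  unfold yCols
  rw [Finset.mem_filter]
  simp

omit [CommRing k] in
/-- Off `Y₀` the two substitutions agree. [cite: BurgisserClausenShokrollahi1997, Thm. (21.29)] -/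
theorem substFirst_eq_of_ne (b b' : k) (x : k ⊕ (σ ⊕ Fin (t + 1))) (hx : x ≠ Sum.inr (Sum.inr 0)) :
    substFirst b x = substFirst b' x := by
  rcases x with c | i | jj
  · rfl
  · rfl
  · cases jj using Fin.cases with
    | zero => exact absurd rfl hx
    | succ j' => rfl

/-- The state-`1` column enumeration: the site columns `s_j` are replaced by `R_{j4}`. [cite: BurgisserClausenShokrollahi1997, Thm. (21.29)] -/
def st1Col (s : Fin N) : GIdx N (yMult A) :=
  if h : s ∈ yCols A then R (yIdx A s h) 3 else o s

omit [CommRing k] in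
/-- The state-`1` column enumeration is injective. [cite: BurgisserClausenShokrollahi1997, Thm. (21.29)] -/
theorem st1Col_injective : Function.Injective (st1Col A) := by
  intro s s' h
  unfold st1Col at h
  by_cases h1 : s ∈ yCols A <;> by_cases h2 : s' ∈ yCols A
  · rw [dif_pos h1, dif_pos h2] at h
    simp only [Sum.inr.injEq, Sum.inl.injEq, Prod.mk.injEq, and_true] at h
    rw [← yCol_yIdx A s h1, ← yCol_yIdx A s' h2, h]
  · rw [dif_pos h1, dif_neg h2] at h; simp at h
  · rw [dif_neg h1, dif_pos h2] at h; simp at h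
  · rw [dif_neg h1, dif_neg h2] at h; simpa using h

omit [CommRing k] in
/-- At the end of state `1` the present columns are exactly the enumerated ones. [cite: BurgisserClausenShokrollahi1997, Thm. (21.29)] -/
theorem st1_zero_iff_range (hμ : 0 < yMult A) (i : GIdx N (yMult A)) :
    St1 A 0 i ↔ i ∈ Set.range (st1Col A) := by
  rcases i with s | ⟨⟨j', p' | p'⟩⟩ | ⟨⟨⟩⟩
  · simp only [St1, zero_le, forall_const, Set.mem_range]
    constructor
    · intro h
      refine ⟨s, ?_⟩
      unfold st1Col
      rw [dif_neg]
      intro hs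
      exact h (yIdx A s hs) (yCol_yIdx A s hs).symm
    · rintro ⟨s', hs'⟩ j' rfl
      unfold st1Col at hs'
      by_cases h1 : s' ∈ yCols A
      · rw [dif_pos h1] at hs'; simp at hs'
      · rw [dif_neg h1] at hs'
        simp only [Sum.inl.injEq] at hs'
        subst hs'
        exact h1 (yCol_mem A j')
  · simp only [St1, Set.mem_range]
    constructor
    · rintro (⟨-, h⟩ | ⟨-, h0, h⟩) <;> omega
    · rintro ⟨s', hs'⟩
      unfold st1Col at hs'
      by_cases h1 : s' ∈ yCols A
      · rw [dif_pos h1] at hs'; simp at hs'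
      · rw [dif_neg h1] at hs'; simp at hs'
  · simp only [St1, Nat.not_lt_zero, false_or, Set.mem_range]
    constructor
    · rintro rfl
      refine ⟨yCol A j', ?_⟩
      unfold st1Col
      rw [dif_pos (yCol_mem A j'), yIdx_yCol]
    · rintro ⟨s', hs'⟩
      unfold st1Col at hs'
      by_cases h1 : s' ∈ yCols A
      · rw [dif_pos h1] at hs'
        simp only [Sum.inr.injEq, Sum.inl.injEq, Prod.mk.injEq] at hs'
        exact hs'.2.symm
      · rw [dif_neg h1] at hs'; simp at hs'
  · simp only [St1, Set.mem_range]
    constructor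
    · intro h; omega
    · rintro ⟨s', hs'⟩
      unfold st1Col at hs'
      by_cases h1 : s' ∈ yCols A
      · rw [dif_pos h1] at hs'; simp at hs'
      · rw [dif_neg h1] at hs'; simp at hs'

omit [CommRing k] in
/-- At the end of state `1` the present rows are the original rows. [cite: BurgisserClausenShokrollahi1997, Thm. (21.29)] -/
theorem st1row_zero_iff_range (y : GIdx N (yMult A)) :
    St1row (μ := yMult A) 0 y ↔ y ∈ Set.range (o (μ := yMult A)) := by
  rcases y with s | ⟨⟨j', pp⟩⟩ | ⟨⟨⟩⟩
  · simp [St1row]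
  · simp [St1row]
  · simp [St1row]

/-- End of state `1`: the original rows, the columns with `s_j` replaced by `R_{j4}`, i.e. the
matrix `A(Y₀ := 1)` up to the order of the columns. [cite: BurgisserClausenShokrollahi1997, Thm. (21.29)] -/
theorem st1_end (hμ : 0 < yMult A) :
    (gadgetM A ε).subperm (St1 A 0) (St1row 0) = entryPer (A.map (substFirst 1)) := by
  rw [(gadgetM A ε).subperm_congr (st1_zero_iff_range A hμ) (st1row_zero_iff_range A),
    (gadgetM A ε).subperm_range_eq_permanent _ _ (st1Col_injective A) Sum.inl_injective]
  unfold entryPer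
  congr 1
  funext a b
  simp only [Matrix.of_apply, Matrix.map_apply]
  change entryVal (gadget A ε (o a) (st1Col A b)) = entryVal (substFirst 1 (A a b))
  congr 1
  unfold st1Col
  by_cases hb : b ∈ yCols A
  · rw [dif_pos hb, gadget_o_R, if_pos rfl, yCol_yIdx]
  · rw [dif_neg hb, gadget_o_o]
    apply substFirst_eq_of_ne
    intro h
    exact hb ((mem_yCols_iff A b).2 ⟨a, h⟩)

end St1Chain

/-! #### The control row: assembling the two states -/

section Control

variable [CommRing k]

omit [CommRing k] in
/-- After the control row takes the control column, the present indices are those of stage `0` of state `0`. [cite: BurgisserClausenShokrollahi1997, Thm. (21.29)] -/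
theorem st0_zero_iff (i : GIdx N (yMult A)) : (True ∧ i ≠ c) ↔ St0 (μ := yMult A) 0 i := by
  rcases i with s | ⟨⟨j', pp⟩⟩ | ⟨⟨⟩⟩ <;> simp [St0]

omit [CommRing k] in
/-- After the control row takes `L_{1,4}`, the present columns are those of the top stage of state `1`. [cite: BurgisserClausenShokrollahi1997, Thm. (21.29)] -/
theorem st1_top_iff (hμ : 0 < yMult A) (i : GIdx N (yMult A)) :
    (True ∧ i ≠ L ⟨0, hμ⟩ 3) ↔ St1 A (yMult A) i := by
  rcases i with s | ⟨⟨j', p' | p'⟩⟩ | ⟨⟨⟩⟩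
  · simp only [St1, true_and]
    constructor
    · intro _ j' hj'; exact absurd j'.isLt (not_lt.2 hj')
    · intro _; simp
  · simp only [St1, true_and, ne_eq, Sum.inr.injEq, Sum.inl.injEq, Prod.mk.injEq]
    have hlt := j'.isLt
    constructor
    · intro h
      by_cases hp : p' = 3
      · right
        refine ⟨hp, fun h0 => h ⟨Fin.ext h0, hp⟩, hlt.le⟩
      · exact Or.inl ⟨hp, hlt⟩
    · rintro (⟨hp, -⟩ | ⟨hp, h0, -⟩) ⟨h1, h2⟩
      · exact hp h2
      · exact h0 (by rw [h1])
  · simp only [St1, true_and]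
    have hlt := j'.isLt
    simp [hlt]
  · simp [St1]

omit [CommRing k] in
/-- After the control row is used, the present rows are those of the top stage of state `1`. [cite: BurgisserClausenShokrollahi1997, Thm. (21.29)] -/
theorem st1row_top_iff (y : GIdx N (yMult A)) : (True ∧ y ≠ c) ↔ St1row (μ := yMult A) (yMult A) y := by
  rcases y with s | ⟨⟨j', pp⟩⟩ | ⟨⟨⟩⟩
  · simp [St1row]
  · simp [St1row, j'.isLt]
  · simp [St1row]

/-- **The permanent of the one-variable gadget**: expanding along the control row (entries `ε` at
`c` and at `L_{1,4}`) splits `per A'` into the state-`0` chain (value `16^μ per A(Y₀:=0)`) and the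
state-`1` chain (value `16^μ per A(Y₀:=1)`) (BCS 1997, proof of Thm. (21.29), pp. 561–563). [cite: BurgisserClausenShokrollahi1997, Thm. (21.29)] -/
theorem permanent_gadgetM (hμ : 0 < yMult A) :
    (gadgetM A ε).permanent = C (ε * 16 ^ yMult A) *
      (entryPer (A.map (substFirst 0)) + entryPer (A.map (substFirst 1))) := by
  have hne : (c : GIdx N (yMult A)) ≠ L ⟨0, hμ⟩ 3 := by simp
  rw [← (gadgetM A ε).subperm_true,
    (gadgetM A ε).subperm_expand_row_support (p := fun _ => True) (q := fun _ => True) c trivial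
      {c, L ⟨0, hμ⟩ 3} (fun i _ hi => by
        apply gadgetM_eq_zero
        by_contra h
        rcases gadget_c_row h with rfl | ⟨j', hj', rfl⟩
        · simp at hi
        · have : j' = ⟨0, hμ⟩ := Fin.ext hj'
          subst this
          simp at hi),
    Finset.filter_true, Finset.sum_pair hne]
  have h1 : gadgetM A ε c c = C ε := by simp
  have h2 : gadgetM A ε c (L ⟨0, hμ⟩ 3) = C ε := by simp
  rw [h1, h2, (gadgetM A ε).subperm_congr (st0_zero_iff A) (st0_zero_iff A),
    (gadgetM A ε).subperm_congr (st1_top_iff A hμ) (st1row_top_iff A),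
    st0_chain A ε (yMult A) le_rfl, st0_end, st1_chain A ε (yMult A) le_rfl, Nat.sub_self,
    st1_end A ε hμ, C_mul]
  ring

end Control

end Chain

/-! ### Structure of the gadget: column property, constant control row, occurrences -/

section Structure

open GIdx

variable {k : Type u} {σ : Type v} {t N : ℕ}

/-- The number of occurrences of `Y`-variables in a square matrix over `k ∪ X ∪ Y`. [cite: BurgisserClausenShokrollahi1997, Thm. (21.29)] -/
def yOcc {ι : Type*} [Fintype ι] {t : ℕ} (M : Matrix ι ι (k ⊕ (σ ⊕ Fin t))) : ℕ := by
  classical exact (univ.filter fun p : ι × ι => ∃ j, M p.1 p.2 = Sum.inr (Sum.inr j)).card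

/-- The number of occurrences of the variables `Y_1, Y_2, …` (all but `Y₀`). [cite: BurgisserClausenShokrollahi1997, Thm. (21.29)] -/
def ySuccOcc (A : Matrix (Fin N) (Fin N) (k ⊕ (σ ⊕ Fin (t + 1)))) : ℕ := by
  classical exact (univ.filter fun p : Fin N × Fin N => ∃ j : Fin t, A p.1 p.2 = Sum.inr (Sum.inr j.succ)).card

/-- The number of `Y`-occurrences is invariant under re-indexing. [cite: BurgisserClausenShokrollahi1997, Thm. (21.29)] -/
theorem yOcc_submatrix_equiv {ι ι' : Type*} [Fintype ι] [Fintype ι'] {t : ℕ}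
    (M : Matrix ι ι (k ⊕ (σ ⊕ Fin t))) (e : ι' ≃ ι) : yOcc (M.submatrix e e) = yOcc M := by
  classical
  unfold yOcc
  refine Finset.card_bij (fun p _ => (e p.1, e p.2)) (fun p hp => ?_) (fun p hp q hq h => ?_)
    (fun q hq => ?_)
  · simpa using hp
  · simp only [Prod.mk.injEq, EmbeddingLike.apply_eq_iff_eq] at h
    exact Prod.ext h.1 h.2
  · refine ⟨(e.symm q.1, e.symm q.2), by simpa using hq, by simp⟩

variable (A : Matrix (Fin N) (Fin N) (k ⊕ (σ ⊕ Fin (t + 1))))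

/-- In a column containing `Y₀`, under the column property every non-constant entry is that `Y₀`. [cite: BurgisserClausenShokrollahi1997, Thm. (21.29)] -/
theorem eq_Y0_of_mem_yCols (hA : HasColumnProperty A) {r : Fin N} {s : Fin N} (hs : s ∈ yCols A)
    (h : (A r s).isRight = true) : A r s = Sum.inr (Sum.inr 0) := by
  obtain ⟨r', hr'⟩ := (mem_yCols_iff A s).1 hs
  have : r = r' := hA s r r' h (by rw [hr']; rfl)
  subst this
  exact hr'

/-- The substitution does not create non-constant entries. [cite: BurgisserClausenShokrollahi1997, Thm. (21.29)] -/
theorem isRight_substFirst {b : k} {x : k ⊕ (σ ⊕ Fin (t + 1))} (h : (substFirst b x).isRight = true) :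
    x.isRight = true := by
  rcases x with c | i | jj
  · simp [substFirst] at h
  · rfl
  · rfl

/-- The substitution sends exactly `Y_{j+1}` to `Y_j`. [cite: BurgisserClausenShokrollahi1997, Thm. (21.29)] -/
theorem substFirst_eq_Y_iff (b : k) (x : k ⊕ (σ ⊕ Fin (t + 1))) (j : Fin t) :
    substFirst b x = Sum.inr (Sum.inr j) ↔ x = Sum.inr (Sum.inr j.succ) := by
  rcases x with c | i | jj
  · simp [substFirst]
  · simp [substFirst]
  · cases jj using Fin.cases with
    | zero => simp [substFirst, (Fin.succ_ne_zero j).symm]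
    | succ j' => simp [substFirst, Fin.succ_inj]

variable [CommRing k] (ε : k)

/-- The control row is constant. [cite: BurgisserClausenShokrollahi1997, Thm. (21.29)] -/
theorem gadget_c_isLeft (y : GIdx N (yMult A)) : (gadget A ε c y).isLeft = true := by
  rcases y with s | ⟨⟨j', p' | p'⟩⟩ | ⟨⟨⟩⟩
  · simp
  · simp only [gadget_c_L]; split_ifs <;> rfl
  · simp
  · simp

/-- **The gadget has the column property** (with respect to the remaining variables). [cite: BurgisserClausenShokrollahi1997, Thm. (21.29)] -/
theorem gadget_col_unique (hA : HasColumnProperty A) (y x x' : GIdx N (yMult A))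
    (hx : (gadget A ε x y).isRight = true) (hx' : (gadget A ε x' y).isRight = true) : x = x' := by
  -- only original rows can carry a non-constant entry
  have key : ∀ x : GIdx N (yMult A), (gadget A ε x y).isRight = true →
      ∃ r, x = o r ∧ ∃ s, y = o s ∧ (A r s).isRight = true := by
    intro x hx
    rcases x with r | ⟨⟨j', p' | p'⟩⟩ | ⟨⟨⟩⟩
    · rcases y with s | ⟨⟨j'', p'' | p''⟩⟩ | ⟨⟨⟩⟩
      · exact ⟨r, rfl, s, rfl, isRight_substFirst (by simpa using hx)⟩
      · simp at hx
      · simp only [gadget_o_R] at hx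
        split_ifs at hx with hp
        · exfalso
          have h1 := isRight_substFirst hx
          have h2 := eq_Y0_of_mem_yCols A hA (yCol_mem A j'') h1
          rw [h2] at hx
          simp [substFirst] at hx
        · simp at hx
      · simp at hx
    · exfalso
      rcases y with s | ⟨⟨j'', p'' | p''⟩⟩ | ⟨⟨⟩⟩
      · simp at hx
      · simp only [gadget_L_L] at hx; split_ifs at hx <;> simp at hx
      · simp only [gadget_L_R] at hx; split_ifs at hx <;> simp at hx
      · simp only [gadget_L_c] at hx; split_ifs at hx <;> simp at hx
    · exfalso
      rcases y with s | ⟨⟨j'', p'' | p''⟩⟩ | ⟨⟨⟩⟩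
      · simp only [gadget_R_o] at hx; split_ifs at hx <;> simp at hx
      · simp only [gadget_R_L] at hx; split_ifs at hx <;> simp at hx
      · simp only [gadget_R_R] at hx; split_ifs at hx <;> simp at hx
      · simp at hx
    · exfalso
      have h1 := gadget_c_isLeft A ε y
      cases h : gadget A ε c y with
      | inl a => rw [h] at hx; exact Bool.false_ne_true hx
      | inr b => rw [h] at h1; exact Bool.false_ne_true h1
  obtain ⟨r, rfl, s, hs, hr⟩ := key x hx
  obtain ⟨r', rfl, s', hs', hr'⟩ := key x' hx'
  rw [hs] at hs'
  have : s = s' := by simpa using hs'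
  subst this
  rw [hA s r r' hr hr']

/-- The `Y`-occurrences of the gadget are the occurrences of `Y_1, Y_2, …` in `A`. [cite: BurgisserClausenShokrollahi1997, Thm. (21.29)] -/
theorem yOcc_gadget (hA : HasColumnProperty A) : yOcc (gadget A ε) = ySuccOcc A := by
  classical
  unfold yOcc ySuccOcc
  symm
  refine Finset.card_bij (fun p _ => (o p.1, o p.2)) (fun p hp => ?_) (fun p _ q _ h => ?_)
    (fun q hq => ?_)
  · simp only [Finset.mem_filter, Finset.mem_univ, true_and] at hp ⊢
    obtain ⟨j, hj⟩ := hp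
    exact ⟨j, by rw [gadget_o_o, substFirst_eq_Y_iff, hj]⟩
  · simp only [Prod.mk.injEq, Sum.inl.injEq] at h
    exact Prod.ext h.1 h.2
  · simp only [Finset.mem_filter, Finset.mem_univ, true_and] at hq
    obtain ⟨j, hj⟩ := hq
    rcases q with ⟨x, y⟩
    dsimp only at hj
    rcases x with r | ⟨⟨j', p' | p'⟩⟩ | ⟨⟨⟩⟩
    · rcases y with s | ⟨⟨j'', p'' | p''⟩⟩ | ⟨⟨⟩⟩
      · refine ⟨(r, s), ?_, rfl⟩
        simp only [Finset.mem_filter, Finset.mem_univ, true_and]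
        exact ⟨j, (substFirst_eq_Y_iff 0 _ j).1 hj⟩
      · simp at hj
      · exfalso
        simp only [gadget_o_R] at hj
        split_ifs at hj with hp
        · have h1 : (A r (yCol A j'')).isRight = true := isRight_substFirst (by rw [hj]; rfl)
          have h2 := eq_Y0_of_mem_yCols A hA (yCol_mem A j'') h1
          rw [h2] at hj
          simp [substFirst] at hj
      · simp at hj
    · exfalso
      rcases y with s | ⟨⟨j'', p'' | p''⟩⟩ | ⟨⟨⟩⟩
      · simp at hj
      · simp only [gadget_L_L] at hj; split_ifs at hj
      · simp only [gadget_L_R] at hj; split_ifs at hj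
      · simp only [gadget_L_c] at hj; split_ifs at hj
    · exfalso
      rcases y with s | ⟨⟨j'', p'' | p''⟩⟩ | ⟨⟨⟩⟩
      · simp only [gadget_R_o] at hj; split_ifs at hj
      · simp only [gadget_R_L] at hj; split_ifs at hj
      · simp only [gadget_R_R] at hj; split_ifs at hj
      · simp at hj
    · exfalso
      rcases y with s | ⟨⟨j'', p'' | p''⟩⟩ | ⟨⟨⟩⟩
      · simp at hj
      · simp only [gadget_c_L] at hj; split_ifs at hj
      · simp at hj
      · simp at hj

omit [CommRing k] in
/-- `yOcc A = μ + #occurrences of the other variables` under the column property. [cite: BurgisserClausenShokrollahi1997, Thm. (21.29)] -/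
theorem yOcc_eq_yMult_add (hA : HasColumnProperty A) : yOcc A = yMult A + ySuccOcc A := by
  classical
  have hsplit : (univ.filter fun p : Fin N × Fin N => ∃ j, A p.1 p.2 = Sum.inr (Sum.inr j)) =
      (univ.filter fun p : Fin N × Fin N => A p.1 p.2 = Sum.inr (Sum.inr 0)) ∪
      (univ.filter fun p : Fin N × Fin N => ∃ j : Fin t, A p.1 p.2 = Sum.inr (Sum.inr j.succ)) := by
    ext p
    simp only [Finset.mem_filter, Finset.mem_univ, true_and, Finset.mem_union, Fin.exists_fin_succ]
  have hdisj : Disjoint (univ.filter fun p : Fin N × Fin N => A p.1 p.2 = Sum.inr (Sum.inr 0))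
      (univ.filter fun p : Fin N × Fin N => ∃ j : Fin t, A p.1 p.2 = Sum.inr (Sum.inr j.succ)) := by
    rw [Finset.disjoint_filter]
    rintro p - h ⟨j, hj⟩
    rw [h] at hj
    simp only [Sum.inr.injEq] at hj
    exact Fin.succ_ne_zero j hj.symm
  have h0 : (univ.filter fun p : Fin N × Fin N => A p.1 p.2 = Sum.inr (Sum.inr 0)).card = yMult A := by
    unfold yMult
    rw [← Finset.card_image_of_injOn (f := Prod.snd)]
    · congr 1
      ext s
      simp only [Finset.mem_image, Finset.mem_filter, Finset.mem_univ, true_and, Prod.exists,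
        exists_eq_right, mem_yCols_iff]
    · rintro ⟨r, s⟩ hp ⟨r', s'⟩ hq h
      simp only [Finset.coe_filter, Finset.mem_univ, true_and, Set.mem_setOf_eq] at hp hq
      dsimp only at h
      subst h
      have : r = r' := hA s r r' (by rw [hp]; rfl) (by rw [hq]; rfl)
      rw [this]
  unfold yOcc ySuccOcc
  rw [hsplit, Finset.card_union_of_disjoint hdisj, h0]

end Structure

/-! ### Reindexing to `Fin` and the elimination of all Boolean variables -/

section Elimination

open GIdx

variable {k : Type u} {σ : Type v}

/-- The gadget index type has `N + 8μ + 1` elements. [cite: BurgisserClausenShokrollahi1997, Thm. (21.29)] -/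
theorem card_GIdx (N μ : ℕ) : Fintype.card (GIdx N μ) = N + (μ * 8 + 1) := by
  simp only [Fintype.card_sum, Fintype.card_prod, Fintype.card_fin, Fintype.card_unit]

/-- An enumeration of the gadget indices by `Fin (N + 8μ + 1)`. [cite: BurgisserClausenShokrollahi1997, Thm. (21.29)] -/
def gIdxEquiv (N μ : ℕ) : Fin (N + (μ * 8 + 1)) ≃ GIdx N μ :=
  (Fintype.equivFinOfCardEq (card_GIdx N μ)).symm

variable {t N : ℕ}

/-- A matrix over `k ∪ X ∪ Y` has a constant row. [cite: BurgisserClausenShokrollahi1997, Thm. (21.29)] -/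
def HasConstRow {τ : Type*} {N : ℕ} (A : Matrix (Fin N) (Fin N) (k ⊕ τ)) : Prop :=
  ∃ r, ∀ s, (A r s).isLeft = true

section Fin

variable [CommRing k] (A : Matrix (Fin N) (Fin N) (k ⊕ (σ ⊕ Fin (t + 1)))) (ε : k)

/-- The one-variable gadget `A'` as a `Fin`-indexed matrix of size `N' = N + 8μ + 1`
(BCS 1997, Thm. (21.29): `N' = N + ∑_i (8 μ_i + 1)`, one variable at a time). [cite: BurgisserClausenShokrollahi1997, Thm. (21.29)] -/
def gadgetFin : Matrix (Fin (N + (yMult A * 8 + 1))) (Fin (N + (yMult A * 8 + 1))) (k ⊕ (σ ⊕ Fin t)) :=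
  (gadget A ε).submatrix (gIdxEquiv N (yMult A)) (gIdxEquiv N (yMult A))

/-- Re-indexing to `Fin` does not change the permanent. [cite: BurgisserClausenShokrollahi1997, Thm. (21.29)] -/
theorem entryPer_gadgetFin : entryPer (gadgetFin A ε) = (gadgetM A ε).permanent := by
  unfold entryPer gadgetFin
  rw [← Matrix.submatrix_map, Matrix.permanent_submatrix_equiv]

/-- The `Fin`-indexed gadget has the column property. [cite: BurgisserClausenShokrollahi1997, Thm. (21.29)] -/
theorem hasColumnProperty_gadgetFin (hA : HasColumnProperty A) : HasColumnProperty (gadgetFin A ε) := by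
  intro j i i' hi hi'
  exact (gIdxEquiv N (yMult A)).injective (gadget_col_unique A ε hA _ _ _ hi hi')

/-- The `Fin`-indexed gadget has a constant row (the control row). [cite: BurgisserClausenShokrollahi1997, Thm. (21.29)] -/
theorem hasConstRow_gadgetFin : HasConstRow (gadgetFin A ε) :=
  ⟨(gIdxEquiv N (yMult A)).symm c, fun s => by
    unfold gadgetFin
    rw [Matrix.submatrix_apply, Equiv.apply_symm_apply]
    exact gadget_c_isLeft A ε _⟩

/-- The `Fin`-indexed gadget has `occ - μ` occurrences of `Y`-variables. [cite: BurgisserClausenShokrollahi1997, Thm. (21.29)] -/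
theorem yOcc_gadgetFin (hA : HasColumnProperty A) : yOcc (gadgetFin A ε) = ySuccOcc A := by
  unfold gadgetFin
  rw [yOcc_submatrix_equiv, yOcc_gadget A ε hA]

end Fin

section BoolSubst

variable [CommRing k]

/-- Substituting a Boolean vector `(b, e)` is substituting `b` for `Y₀` first. [cite: BurgisserClausenShokrollahi1997, Thm. (21.29)] -/
theorem boolSubst_cons (A : Matrix (Fin N) (Fin N) (k ⊕ (σ ⊕ Fin (t + 1)))) (b : Bool) (e : Fin t → Bool) :
    boolSubst A (Fin.cons b e) = boolSubst (A.map (substFirst (if b then 1 else 0))) e := by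
  ext r s
  simp only [boolSubst, Matrix.map_apply]
  rcases A r s with c | i | jj
  · rfl
  · rfl
  · cases jj using Fin.cases with
    | zero => simp [boolSubstEntry, substFirst]
    | succ j => simp [boolSubstEntry, substFirst]

/-- Splitting the Boolean sum at the first variable. [cite: BurgisserClausenShokrollahi1997, Thm. (21.29)] -/
theorem sum_entryPer_boolSubst_succ (A : Matrix (Fin N) (Fin N) (k ⊕ (σ ⊕ Fin (t + 1)))) :
    ∑ e : Fin (t + 1) → Bool, entryPer (boolSubst A e) =
      ∑ e : Fin t → Bool, (entryPer (boolSubst (A.map (substFirst 0)) e) +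
        entryPer (boolSubst (A.map (substFirst 1)) e)) := by
  rw [← Fintype.sum_equiv (Fin.consEquiv fun _ => Bool)
      (fun p => entryPer (boolSubst A (Fin.cons p.1 p.2))) _ (fun p => rfl),
    Fintype.sum_prod_type, Fintype.sum_bool, ← Finset.sum_add_distrib]
  refine Finset.sum_congr rfl fun e _ => ?_
  rw [boolSubst_cons, boolSubst_cons, add_comm]
  simp

/-- Scaling the constant entries of a row. [cite: BurgisserClausenShokrollahi1997, Thm. (21.29)] -/
def scaleRow {τ : Type*} (A : Matrix (Fin N) (Fin N) (k ⊕ τ)) (r₀ : Fin N) (a : k) :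
    Matrix (Fin N) (Fin N) (k ⊕ τ) :=
  A.updateRow r₀ fun s => Sum.map (a * ·) id (A r₀ s)

/-- Entries of a row-scaled matrix. [cite: BurgisserClausenShokrollahi1997, Thm. (21.29)] -/
theorem scaleRow_apply {τ : Type*} (A : Matrix (Fin N) (Fin N) (k ⊕ τ)) (r₀ : Fin N) (a : k) (r s : Fin N) :
    scaleRow A r₀ a r s = if r = r₀ then Sum.map (a * ·) id (A r₀ s) else A r s := by
  unfold scaleRow
  rw [Matrix.updateRow_apply]

/-- Scaling a constant row multiplies every Boolean substitution's permanent. [cite: BurgisserClausenShokrollahi1997, Thm. (21.29)] -/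
theorem entryPer_boolSubst_scaleRow (A : Matrix (Fin N) (Fin N) (k ⊕ (σ ⊕ Fin t))) (r₀ : Fin N)
    (hr : ∀ s, (A r₀ s).isLeft = true) (a : k) (e : Fin t → Bool) :
    entryPer (boolSubst (scaleRow A r₀ a) e) = C a * entryPer (boolSubst A e) := by
  unfold entryPer
  have key : (boolSubst (scaleRow A r₀ a) e).map entryVal =
      ((boolSubst A e).map entryVal).updateRow r₀
        ((C a : MvPolynomial σ k) • fun s => entryVal (boolSubstEntry e (A r₀ s))) := by
    ext r s
    simp only [boolSubst, Matrix.map_apply, scaleRow_apply, Matrix.updateRow_apply, Pi.smul_apply,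
      smul_eq_mul]
    split_ifs with h
    · subst h
      cases hx : A r s with
      | inl c => simp [boolSubstEntry, C_mul]
      | inr v => have := hr s; rw [hx] at this; exact absurd this (by simp)
    · rfl
  rw [key, Matrix.permanent_updateRow_smul]
  congr 1
  conv_rhs => rw [← Matrix.updateRow_eq_self ((boolSubst A e).map entryVal) r₀]
  rfl

/-- Scaling a row preserves the column property. [cite: BurgisserClausenShokrollahi1997, Thm. (21.29)] -/
theorem hasColumnProperty_scaleRow {τ : Type*} (A : Matrix (Fin N) (Fin N) (k ⊕ τ)) (hA : HasColumnProperty A)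
    (r₀ : Fin N) (a : k) : HasColumnProperty (scaleRow A r₀ a) := by
  intro j i i' hi hi'
  rw [scaleRow_apply] at hi hi'
  apply hA j i i'
  · split_ifs at hi with h
    · subst h; simpa [Sum.isRight_map] using hi
    · exact hi
  · split_ifs at hi' with h
    · subst h; simpa [Sum.isRight_map] using hi'
    · exact hi'

/-- Scaling a constant row preserves the number of `Y`-occurrences. [cite: BurgisserClausenShokrollahi1997, Thm. (21.29)] -/
theorem yOcc_scaleRow (A : Matrix (Fin N) (Fin N) (k ⊕ (σ ⊕ Fin t))) (r₀ : Fin N)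
    (hr : ∀ s, (A r₀ s).isLeft = true) (a : k) : yOcc (scaleRow A r₀ a) = yOcc A := by
  classical
  unfold yOcc
  congr 1
  ext ⟨r, s⟩
  simp only [Finset.mem_filter, Finset.mem_univ, true_and, scaleRow_apply]
  split_ifs with h
  · subst h
    cases hx : A r s with
    | inl c => simp
    | inr v => have := hr s; rw [hx] at this; exact absurd this (by simp)
  · exact Iff.rfl

end BoolSubst

section Occ

variable (A : Matrix (Fin N) (Fin N) (k ⊕ (σ ⊕ Fin t)))

/-- Under the column property the `Y`-occurrences sit in distinct columns: `yOcc A ≤ N`. [cite: BurgisserClausenShokrollahi1997, Thm. (21.29)] -/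
theorem yOcc_le_card_cols (hA : HasColumnProperty A) (S : Finset (Fin N))
    (hS : ∀ r s, (∃ j, A r s = Sum.inr (Sum.inr j)) → s ∈ S) : yOcc A ≤ S.card := by
  classical
  unfold yOcc
  rw [← Finset.card_image_of_injOn (f := Prod.snd)]
  · apply Finset.card_le_card
    intro s hs
    simp only [Finset.mem_image, Finset.mem_filter, Finset.mem_univ, true_and, Prod.exists,
      exists_eq_right] at hs
    obtain ⟨r, hr⟩ := hs
    exact hS r s hr
  · rintro ⟨r, s⟩ hp ⟨r', s'⟩ hq h
    simp only [Finset.coe_filter, Finset.mem_univ, true_and, Set.mem_setOf_eq] at hp hq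
    dsimp only at h
    subst h
    obtain ⟨j, hj⟩ := hp
    obtain ⟨j', hj'⟩ := hq
    have : r = r' := hA s r r' (by rw [hj]; rfl) (by rw [hj']; rfl)
    rw [this]

/-- `occ ≤ N` under the column property. [cite: BurgisserClausenShokrollahi1997, Thm. (21.29)] -/
theorem yOcc_le (hA : HasColumnProperty A) : yOcc A ≤ N := by
  simpa using yOcc_le_card_cols A hA Finset.univ (fun _ _ _ => Finset.mem_univ _)

/-- If some column carries an `X`-variable then `occ ≤ N - 1`. [cite: BurgisserClausenShokrollahi1997, Thm. (21.29)] -/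
theorem yOcc_le_pred (hA : HasColumnProperty A) {r₀ s₀ : Fin N} {i : σ} (hX : A r₀ s₀ = Sum.inr (Sum.inl i)) :
    yOcc A ≤ N - 1 := by
  classical
  have h := yOcc_le_card_cols A hA (Finset.univ.erase s₀) (fun r s ⟨j, hj⟩ => by
    rw [Finset.mem_erase]
    refine ⟨?_, Finset.mem_univ _⟩
    rintro rfl
    have : r = r₀ := hA s r r₀ (by rw [hj]; rfl) (by rw [hX]; rfl)
    subst this
    rw [hX] at hj
    simp at hj)
  rwa [Finset.card_erase_of_mem (Finset.mem_univ _), Finset.card_univ, Fintype.card_fin] at h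

end Occ

section Main

variable [Field k]

/-- **Elimination of all Boolean variables** (the induction behind BCS 1997, Thm. (21.29), one
variable at a time): a matrix with the column property and a constant row, of size `N` with
`occ` occurrences of `Y`-variables, has a Boolean sum of permanents equal to the permanent of a
single matrix over `k ∪ X` of size `≤ N + 9·occ`. [cite: BurgisserClausenShokrollahi1997, Thm. (21.29)] -/
theorem elim_boolSum (h2 : (2 : k) ≠ 0) (t : ℕ) : ∀ {N : ℕ} (A : Matrix (Fin N) (Fin N) (k ⊕ (σ ⊕ Fin t))),
    HasColumnProperty A → HasConstRow A →
    ∃ N', N' ≤ N + 9 * yOcc A ∧ ∃ A' : Matrix (Fin N') (Fin N') (k ⊕ σ),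
      entryPer A' = ∑ e : Fin t → Bool, entryPer (boolSubst A e) := by
  induction t with
  | zero =>
    intro N A _ _
    refine ⟨N, by omega, boolSubst A default, ?_⟩
    rw [Fintype.sum_unique]
    exact congrArg _ (congrArg _ (Subsingleton.elim _ _))
  | succ t ih =>
    intro N A hA hrow
    by_cases hμ : yMult A = 0
    · -- `Y₀` does not occur: double, using the constant row
      obtain ⟨r₀, hr₀⟩ := hrow
      have h01 : A.map (substFirst (1 : k)) = A.map (substFirst 0) := by
        ext r s
        simp only [Matrix.map_apply]
        apply substFirst_eq_of_ne
        intro h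
        have hs : s ∈ yCols A := (mem_yCols_iff A s).2 ⟨r, h⟩
        unfold yMult at hμ
        rw [Finset.card_eq_zero.1 hμ] at hs
        simp at hs
      have hr₀' : ∀ s, ((A.map (substFirst (0 : k))) r₀ s).isLeft = true := by
        intro s
        simp only [Matrix.map_apply]
        cases hx : A r₀ s with
        | inl c => rfl
        | inr v => have := hr₀ s; rw [hx] at this; exact absurd this (by simp)
      have hcol : HasColumnProperty (A.map (substFirst (0 : k))) := by
        intro j i i' hi hi'
        exact hA j i i' (isRight_substFirst hi) (isRight_substFirst hi')
      obtain ⟨N', hN', A', hA'⟩ := ih (scaleRow (A.map (substFirst 0)) r₀ 2)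
        (hasColumnProperty_scaleRow _ hcol r₀ 2) ⟨r₀, fun s => by
          rw [scaleRow_apply, if_pos rfl]
          cases hx : (A.map (substFirst (0 : k))) r₀ s with
          | inl c => rfl
          | inr v => have := hr₀' s; rw [hx] at this; exact absurd this (by simp)⟩
      refine ⟨N', ?_, A', ?_⟩
      · rw [yOcc_scaleRow _ r₀ hr₀'] at hN'
        have h1 : yOcc (A.map (substFirst (0 : k))) = ySuccOcc A := by
          classical
          unfold yOcc ySuccOcc
          congr 1
          ext ⟨r, s⟩
          simp only [Finset.mem_filter, Finset.mem_univ, true_and, Matrix.map_apply, substFirst_eq_Y_iff]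
        rw [h1] at hN'
        have h3 := yOcc_eq_yMult_add A hA
        omega
      · rw [hA', sum_entryPer_boolSubst_succ, h01]
        refine Finset.sum_congr rfl fun e _ => ?_
        rw [entryPer_boolSubst_scaleRow _ r₀ hr₀', show (C 2 : MvPolynomial σ k) = 2 from map_ofNat C 2,
          two_mul]
    · -- the gadget
      have hμ' : 0 < yMult A := Nat.pos_of_ne_zero hμ
      have h16 : (16 : k) ^ yMult A ≠ 0 := by
        apply pow_ne_zero
        have : (16 : k) = 2 ^ 4 := by norm_num
        rw [this]
        exact pow_ne_zero _ h2
      set ε : k := ((16 : k) ^ yMult A)⁻¹ with hε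
      obtain ⟨N', hN', A', hA'⟩ := ih (gadgetFin A ε) (hasColumnProperty_gadgetFin A ε hA)
        (hasConstRow_gadgetFin A ε)
      refine ⟨N', ?_, A', ?_⟩
      · rw [yOcc_gadgetFin A ε hA] at hN'
        have h3 := yOcc_eq_yMult_add A hA
        omega
      · rw [hA', sum_entryPer_boolSubst_succ]
        refine Finset.sum_congr rfl fun e _ => ?_
        rw [entryPer_boolSubst, entryPer_gadgetFin, permanent_gadgetM A ε hμ', hε,
          inv_mul_cancel₀ h16, C_1, one_mul, map_add, ← entryPer_boolSubst, ← entryPer_boolSubst]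

/-- Case II of the main theorem: without `X`-entries every Boolean substitution is a constant
matrix. [cite: BurgisserClausenShokrollahi1997, Thm. (21.29)] -/
theorem entryPer_boolSubst_of_noX (A : Matrix (Fin N) (Fin N) (k ⊕ (σ ⊕ Fin t)))
    (hX : ∀ r s i, A r s ≠ Sum.inr (Sum.inl i)) (e : Fin t → Bool) :
    entryPer (boolSubst A e) =
      C (Matrix.of fun r s => Sum.elim id (fun _ => (0 : k)) (boolSubstEntry e (A r s))).permanent := by
  unfold entryPer
  rw [← Matrix.permanent_map_ringHom (C : k →+* MvPolynomial σ k)]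
  congr 1
  ext r s
  simp only [boolSubst, Matrix.map_apply, Matrix.of_apply]
  rcases hx : A r s with c | i | j
  · simp [boolSubstEntry]
  · exact absurd hx (hX r s i)
  · simp only [boolSubstEntry]
    split_ifs <;> simp

/-- Adjoining a `1 × 1` unit block. [cite: BurgisserClausenShokrollahi1997, Thm. (21.29)] -/
def extendOne {τ : Type*} (A : Matrix (Fin N) (Fin N) (k ⊕ τ)) : Matrix (Fin (N + 1)) (Fin (N + 1)) (k ⊕ τ) :=
  (Matrix.fromBlocks A (fun _ _ => Sum.inl 0) (fun _ _ => Sum.inl 0) (fun _ _ => Sum.inl 1)).submatrix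
    (finSumFinEquiv.symm.trans (Equiv.sumCongr (Equiv.refl (Fin N)) finOneEquiv))
    (finSumFinEquiv.symm.trans (Equiv.sumCongr (Equiv.refl (Fin N)) finOneEquiv))

/-- Adjoining a unit block does not change the Boolean substitutions' permanents. [cite: BurgisserClausenShokrollahi1997, Thm. (21.29)] -/
theorem entryPer_boolSubst_extendOne (A : Matrix (Fin N) (Fin N) (k ⊕ (σ ⊕ Fin t))) (e : Fin t → Bool) :
    entryPer (boolSubst (extendOne A) e) = entryPer (boolSubst A e) := by
  unfold entryPer extendOne boolSubst
  rw [← Matrix.submatrix_map, ← Matrix.submatrix_map, Matrix.permanent_submatrix_equiv]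
  have key : ((Matrix.fromBlocks A (fun _ _ => Sum.inl 0) (fun _ _ => Sum.inl 0) (fun _ _ => Sum.inl 1)).map
      (boolSubstEntry e)).map (entryVal : k ⊕ σ → MvPolynomial σ k) =
      Matrix.fromBlocks ((A.map (boolSubstEntry e)).map entryVal) (0 : Matrix (Fin N) Unit _)
        (0 : Matrix Unit (Fin N) _) (1 : Matrix Unit Unit (MvPolynomial σ k)) := by
    ext (i | i) (j | j)
    · rfl
    · simp [boolSubstEntry]
    · simp [boolSubstEntry]
    · simp [boolSubstEntry]
  rw [key, Matrix.permanent_fromBlocks_zero₂₁, Matrix.permanent_one, mul_one]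

/-- Adjoining a unit block preserves the column property. [cite: BurgisserClausenShokrollahi1997, Thm. (21.29)] -/
theorem hasColumnProperty_extendOne {τ : Type*} (A : Matrix (Fin N) (Fin N) (k ⊕ τ)) (hA : HasColumnProperty A) :
    HasColumnProperty (extendOne A) := by
  intro j i i' hi hi'
  unfold extendOne at hi hi'
  simp only [Matrix.submatrix_apply] at hi hi'
  apply (finSumFinEquiv.symm.trans (Equiv.sumCongr (Equiv.refl (Fin N)) finOneEquiv)).injective
  generalize (finSumFinEquiv.symm.trans (Equiv.sumCongr (Equiv.refl (Fin N)) finOneEquiv)) j = y at hi hi'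
  generalize (finSumFinEquiv.symm.trans (Equiv.sumCongr (Equiv.refl (Fin N)) finOneEquiv)) i = x at hi ⊢
  generalize (finSumFinEquiv.symm.trans (Equiv.sumCongr (Equiv.refl (Fin N)) finOneEquiv)) i' = x' at hi' ⊢
  rcases y with s | u
  · rcases x with r | u1
    · rcases x' with r' | u2
      · simp only [Matrix.fromBlocks_apply₁₁] at hi hi'
        rw [hA s r r' hi hi']
      · simp at hi'
    · simp at hi
  · rcases x with r | u1 <;> simp at hi

/-- The adjoined row is constant. [cite: BurgisserClausenShokrollahi1997, Thm. (21.29)] -/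
theorem hasConstRow_extendOne {τ : Type*} (A : Matrix (Fin N) (Fin N) (k ⊕ τ)) : HasConstRow (extendOne A) := by
  set e := (finSumFinEquiv.symm.trans (Equiv.sumCongr (Equiv.refl (Fin N)) finOneEquiv)) with he
  refine ⟨e.symm (Sum.inr ()), fun s => ?_⟩
  unfold extendOne
  rw [Matrix.submatrix_apply, ← he, Equiv.apply_symm_apply]
  rcases e s with r | u <;> rfl

/-- Adjoining a unit block preserves the number of `Y`-occurrences. [cite: BurgisserClausenShokrollahi1997, Thm. (21.29)] -/
theorem yOcc_extendOne (A : Matrix (Fin N) (Fin N) (k ⊕ (σ ⊕ Fin t))) : yOcc (extendOne A) = yOcc A := by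
  classical
  unfold extendOne
  rw [yOcc_submatrix_equiv]
  unfold yOcc
  symm
  refine Finset.card_bij (fun p _ => (Sum.inl p.1, Sum.inl p.2)) (fun p hp => by simpa using hp)
    (fun p _ q _ h => by
      simp only [Prod.mk.injEq, Sum.inl.injEq] at h
      exact Prod.ext h.1 h.2)
    (fun q hq => ?_)
  simp only [Finset.mem_filter, Finset.mem_univ, true_and] at hq
  obtain ⟨j, hj⟩ := hq
  rcases q with ⟨x | u, y | u'⟩
  · exact ⟨(x, y), by
      simp only [Finset.mem_filter, Finset.mem_univ, true_and]
      exact ⟨j, by simpa using hj⟩, rfl⟩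
  · simp at hj
  · simp at hj
  · simp at hj

end Main

end Elimination

end Literature.Computability.AlgebraicComplexity

/-! ### Discharge of the named fact -/

namespace Literature.Computability.AlgebraicComplexity

universe u'

/-- In a field of characteristic `≠ 2`, `2 ≠ 0`. [folklore] -/
theorem two_ne_zero_of_ringChar_ne_two {k : Type u'} [Field k] (h : ringChar k ≠ 2) : (2 : k) ≠ 0 := by
  intro h2
  have hdvd : ringChar k ∣ 2 := (ringChar.spec k 2).1 (by exact_mod_cast h2)
  rcases (Nat.dvd_prime Nat.prime_two).1 hdvd with h1 | h1
  · exact CharP.ringChar_ne_one h1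
  · exact h h1

/-- **Discharge of `BCS1997_thm_21_29`** (Valiant 1979; BCS 1997, Thm. (21.29)): in characteristic
`≠ 2`, for an `N × N` matrix `A` (`N ≥ 1`) over `k ∪ {X_i} ∪ {Y_j}` with at most one non-constant
entry per column, the Boolean sum `∑_{e ∈ {0,1}^t} per A(X, e)` is the permanent of a single matrix
`A'` over `k ∪ {X_i}` of size `≤ 10 N`. The variables are eliminated one at a time with the
`4 × 4` Valiant-matrix gadgets (`elim_boolSum`); see the module docstring for the three cases of
the size bookkeeping. [cite: BurgisserClausenShokrollahi1997, Thm. (21.29)] -/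
theorem BCS1997_thm_21_29_holds (k : Type u') [Field k] : BCS1997_thm_21_29 k := by
  intro hchar σ N t A hA hN
  have h2 := two_ne_zero_of_ringChar_ne_two hchar
  by_cases hrow : HasConstRow A
  · -- Case I: a constant row is available
    obtain ⟨N', hN', A', hA'⟩ := elim_boolSum h2 t A hA hrow
    have := yOcc_le A hA
    exact ⟨N', by omega, A', hA'⟩
  by_cases hX : ∃ r s i, A r s = Sum.inr (Sum.inl i)
  · -- Case III: an `X`-entry occupies a column, so `occ ≤ N - 1`; adjoin a unit block
    obtain ⟨r₀, s₀, i, hX⟩ := hX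
    obtain ⟨N', hN', A', hA'⟩ := elim_boolSum h2 t (extendOne A) (hasColumnProperty_extendOne A hA)
      (hasConstRow_extendOne A)
    rw [yOcc_extendOne] at hN'
    have := yOcc_le_pred A hA hX
    refine ⟨N', by omega, A', ?_⟩
    rw [hA']
    exact Finset.sum_congr rfl fun e _ => entryPer_boolSubst_extendOne A e
  · -- Case II: no `X` at all: the Boolean sum is a constant
    push Not at hX
    refine ⟨1, by omega, Matrix.of fun _ _ => Sum.inl (∑ e : Fin t → Bool,
      (Matrix.of fun r s => Sum.elim id (fun _ => (0 : k)) (boolSubstEntry e (A r s))).permanent), ?_⟩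
    unfold entryPer
    rw [Matrix.permanent_unique]
    simp only [Matrix.map_apply, Matrix.of_apply, entryVal_inl, map_sum]
    exact Finset.sum_congr rfl fun e _ => (entryPer_boolSubst_of_noX A hX e).symm

end Literature.Computability.AlgebraicComplexity
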